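import Literature.MathematicalPhysics.QuantumLattice.YangMillsHeatFlowDecay
import Literature.MathematicalPhysics.QuantumLattice.YangMillsHeatFlowDivBochner
import Literature.Analysis.PDE.HeatSubsolutionMeanValue
import HarnessLib

/-!
# `ε`-regularity for the Yang–Mills flow in dimension four, `k = 0` (Waldron 2019, Prop. 3.1(a))

QuantumLattice support file (everything proved; no definitions, no named facts) on the proof
path of `Literature.MathematicalPhysics.QuantumLattice.Waldron2019_yangMillsFlow_flatTorus`
(A. Waldron, *Long-time existence for Yang–Mills flow*, Invent. math. 217 (2019), Thm 1.1 /
Cor. 1.2). Waldron cites the `ε`-regularity theorem Prop. 3.1 from his earlier paper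
([instantons], Prop. 3.2; originally Chen–Shen, Struwe, Weinkove); here we PROVE its `k = 0`
curvature bound in the flat setting, for a jointly smooth `𝔲(m)`-valued solution
`∂ₜA = div_A F_A` on an open time set `𝒯 ⊇ [τ − R², τ]`:

  `sup_{[τ−R², τ]} ∫_{B_R(x₀)} e ≤ ε < ε₀  ⟹  e(t, x) ≤ C R⁻⁶ ∫_{τ−R²}^{τ} ∫_{B_R(x₀)} e ≤ C ε R⁻⁴`

for `t ∈ [τ − R²/2, τ]`, `x ∈ B̄_{R/2}(x₀)` (`e = ymDensityOfBasis = |F|²`-density), i.e.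
`‖F(t)‖_{L^∞(B_{R/2})} ≲ R⁻³ ‖F‖_{L²(B_R × [τ−R², τ])} ≲ R⁻² √ε` — Prop. 3.1(a) for `k = 0`.

Proof (Schoen's trick + Moser's mean-value inequality, no monotonicity formula is needed in the
critical dimension four because the energy hypothesis is inherited by every smaller ball):
* `ymDensity_le_mul_integral_of_le` — if `e ≤ M` on a parabolic cylinder `Q_ρ(t, x)` with
  `8√2 (card ι)³ √M ρ² ≤ 1`, then by the Bochner inequality
  `∂ₜe − Δe ≤ 8√2(card ι)³ e^{3/2}` (`deriv_ymDensityOfBasis_sub_laplacian_le`) the function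
  `e^{Λ(t−s)} e(s, y)` (`Λ = 8√2(card ι)³√M`) is a nonnegative subsolution of the heat equation on
  `Q_ρ(t, x)`, so the parabolic mean-value inequality
  (`Literature.Analysis.PDE.le_mul_integral_of_heat_subsolution_basis`) gives
  `e(t, x) ≤ e·C ρ⁻⁶ ∫∫_{Q_ρ(t,x)} e`;
* `sup_weighted_ymDensity_le` — Schoen's trick: maximising `(R − r)⁴ e(t, x)` over the compact
  set `{0 ≤ r ≤ R, τ − r² ≤ t ≤ τ, |x − x₀| ≤ r}` and applying the previous step at the maximum
  with `ρ = min((R − r₀)/2, Λ^{-1/2})` yields `(R − r)⁴ e(t, x) ≤ 16 e C ε` once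
  `ε < ε₀ = (16 e C (8√2(card ι)³)²)⁻¹`;
* `Waldron2019_prop_3_1a` — the two displayed bounds;
* `Waldron2019_prop_3_1b` — the `D^*F` bound (Prop. 3.1(b), `k = 0`):
  `|D^*F(t, x)|² ≤ C R⁻⁶ ∫_{τ−R²}^{τ}∫_{B_R(x₀)} |D^*F|²` for `t ∈ [τ − R²/2, τ]`, `x ∈ B̄_{R/2}(x₀)`,
  from the Bochner inequality for `|D^*F|²` (`deriv_divDensity_sub_laplacian_le`,
  Waldron 2016 Lemma 3.5) — a linear subsolution inequality once `|F| ≲ √ε R⁻²` — and the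
  mean-value inequality for linear subsolutions.

References: A. Waldron, Invent. math. 217 (2019), Prop. 3.1 [Waldron2019]; A. Waldron,
*Instantons and singularities in the Yang–Mills flow*, Calc. Var. PDE 55 (2016), Prop. 3.2 /
Lemma 3.1 of arXiv:1402.3224 [Waldron2016]; R. Schoen, Analytic aspects of the harmonic map
problem (1984), and M. Struwe, J. Differential Geom. 28 (1988) (the `sup (R−r)^k e` trick);
G. M. Lieberman, *Second Order Parabolic Differential Equations*, Thm. 6.17/7.36 [Lieberman1996].
-/

noncomputable section

open scoped ContDiff Topology RealInnerProductSpace Matrix NNReal ENNReal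
open Set Filter MeasureTheory Metric

namespace Literature.MathematicalPhysics.QuantumLattice

section EpsilonRegularity

open scoped Matrix.Norms.Frobenius

attribute [local instance] frobeniusInnerProductSpace

variable {m : Type*} [Fintype m] [DecidableEq m]
variable {E : Type*} [NormedAddCommGroup E] [InnerProductSpace ℝ E] [FiniteDimensional ℝ E]
  [MeasurableSpace E] [BorelSpace E]
variable {ι : Type*} [Fintype ι] [LinearOrder ι]

/-- Finite differentiability orders are below `∞`. [folklore] -/
private theorem natCast_le_infty₅ (n : ℕ) : (n : WithTop ℕ∞) ≤ (⊤ : ℕ∞) := by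
  exact_mod_cast le_top

omit [FiniteDimensional ℝ E] [MeasurableSpace E] [BorelSpace E] in
/-- **Joint smoothness of the energy density** along a jointly smooth family of connections.
[folklore] -/
theorem contDiffOn_ymDensityOfBasis_joint_infty (b : OrthonormalBasis ι ℝ E)
    {A : ℝ → Connection E (Matrix m m ℂ)} {𝒯 : Set ℝ} (h𝒯 : IsOpen 𝒯)
    (hA : ContDiffOn ℝ ∞ (fun p : ℝ × E => A p.1 p.2) (𝒯 ×ˢ (univ : Set E))) :
    ContDiffOn ℝ ∞ (fun p : ℝ × E => ymDensityOfBasis b (A p.1) p.2) (𝒯 ×ˢ (univ : Set E)) := by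
  have heq : (fun p : ℝ × E => ymDensityOfBasis b (A p.1) p.2) =
      fun p => (∑ i, ∑ j, ‖curvature (A p.1) p.2 (b i) (b j)‖ ^ 2) / 2 :=
    funext fun p => ymDensityOfBasis_eq_half_sum b (A p.1) p.2
  rw [heq]
  refine ContDiffOn.div_const (ContDiffOn.sum fun i _ => ContDiffOn.sum fun j _ => ?_) 2
  have h1 : ContDiffOn ℝ ∞ (fun p : ℝ × E => curvature (A p.1) p.2 (b i) (b j))
      (𝒯 ×ˢ (univ : Set E)) :=
    contDiffOn_curvature_joint (h𝒯.prod isOpen_univ) hA (m := ∞) (by norm_cast) (b i) (b j)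
  exact h1.norm_sq ℝ

omit [FiniteDimensional ℝ E] [MeasurableSpace E] [BorelSpace E] in
/-- Time slices `s ↦ e(s, y)` of the energy density are differentiable at interior times, with
derivative `deriv`. [folklore] -/
theorem hasDerivAt_ymDensityOfBasis_tslice_of_isOpen (b : OrthonormalBasis ι ℝ E)
    {A : ℝ → Connection E (Matrix m m ℂ)} {𝒯 : Set ℝ} (h𝒯 : IsOpen 𝒯)
    (hA : ContDiffOn ℝ ∞ (fun p : ℝ × E => A p.1 p.2) (𝒯 ×ˢ (univ : Set E)))
    {s : ℝ} (hs : s ∈ 𝒯) (y : E) :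
    HasDerivAt (fun s' => ymDensityOfBasis b (A s') y)
      (deriv (fun s' => ymDensityOfBasis b (A s') y) s) s := by
  have he := contDiffOn_ymDensityOfBasis_joint_infty b h𝒯 hA
  have hd : DifferentiableAt ℝ (fun p : ℝ × E => ymDensityOfBasis b (A p.1) p.2) (s, y) :=
    (he.differentiableOn (by simp)).differentiableAt
      ((h𝒯.prod isOpen_univ).mem_nhds ⟨hs, mem_univ _⟩)
  have hc : HasDerivAt (fun s' : ℝ => ((s', y) : ℝ × E)) ((1 : ℝ), (0 : E)) s :=
    (hasDerivAt_id s).prodMk (hasDerivAt_const s y)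
  have h := hd.hasFDerivAt.comp_hasDerivAt s hc
  have h' : HasDerivAt (fun s' => ymDensityOfBasis b (A s') y)
      (fderiv ℝ (fun p : ℝ × E => ymDensityOfBasis b (A p.1) p.2) (s, y) (1, 0)) s := by
    simpa [Function.comp_def] using h
  rwa [h'.deriv]

/-- **Mean-value step.** There is `C_m = C_m(E, ι) > 0` such that for every jointly smooth
`𝔲(m)`-valued solution of the Yang–Mills heat equation on an open time set `𝒯`, every parabolic
cylinder `[t − ρ², t] × B̄_ρ(x)` with `[t − ρ², t] ⊆ 𝒯` on which `e ≤ M` with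
`8√2 (card ι)³ √M ρ² ≤ 1`, one has `e(t, x) ≤ C_m ρ⁻⁶ ∫_{t−ρ²}^{t} ∫_{B̄_ρ(x)} e`
(the Bochner inequality makes `e^{Λ(t−s)}e` a subsolution of the heat equation; parabolic
mean-value inequality). [cite: Waldron2019, Prop. 3.1(a) (k = 0), proof via Waldron2016 Prop. 3.2] -/
theorem ymDensity_le_mul_integral_of_le (hE : Module.finrank ℝ E = 4) (b : OrthonormalBasis ι ℝ E) :
    ∃ Cm : ℝ, 0 < Cm ∧ ∀ {A : ℝ → Connection E (Matrix m m ℂ)} {𝒯 : Set ℝ}, IsOpen 𝒯 →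
      ContDiffOn ℝ ∞ (fun p : ℝ × E => A p.1 p.2) (𝒯 ×ˢ (univ : Set E)) →
      (∀ ⦃s : ℝ⦄, s ∈ 𝒯 → (A s).IsValuedIn (skewAdjoint.submodule ℝ (Matrix m m ℂ))) →
      (∀ ⦃s : ℝ⦄, s ∈ 𝒯 → ∀ y w, deriv (fun s' => A s' y w) s = divCurvature (A s) y w) →
      ∀ {t : ℝ} {x : E} {ρ M : ℝ}, 0 < ρ → Icc (t - ρ ^ 2) t ⊆ 𝒯 → 0 ≤ M →
      (∀ s ∈ Icc (t - ρ ^ 2) t, ∀ y ∈ closedBall x ρ, ymDensityOfBasis b (A s) y ≤ M) →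
      8 * Real.sqrt 2 * (Fintype.card ι : ℝ) ^ 3 * Real.sqrt M * ρ ^ 2 ≤ 1 →
      ymDensityOfBasis b (A t) x ≤ Cm / ρ ^ 6 *
        ∫ s in (t - ρ ^ 2)..t, ∫ y in closedBall x ρ, ymDensityOfBasis b (A s) y := by
  obtain ⟨C, hC, hMV⟩ := Analysis.PDE.le_mul_integral_of_heat_subsolution_basis (E := E) b
  refine ⟨Real.exp 1 * C, by positivity, ?_⟩
  intro A 𝒯 h𝒯 hA hval hpde t x ρ M hρ hI hM hbd hΛ
  set A₃ : ℝ := 8 * Real.sqrt 2 * (Fintype.card ι : ℝ) ^ 3 with hA₃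
  have hA₃0 : 0 ≤ A₃ := by positivity
  set Λ : ℝ := A₃ * Real.sqrt M with hΛdef
  have hΛ0 : 0 ≤ Λ := by positivity
  have hΛρ : Λ * ρ ^ 2 ≤ 1 := by rw [hΛdef, hA₃]; exact hΛ
  set e : ℝ → E → ℝ := fun s y => ymDensityOfBasis b (A s) y with he_def
  set w : ℝ → E → ℝ := fun s y => Real.exp (Λ * (t - s)) * e s y with hw_def
  have hO : IsOpen (𝒯 ×ˢ (univ : Set E)) := h𝒯.prod isOpen_univ
  have he_joint : ContDiffOn ℝ ∞ (fun p : ℝ × E => e p.1 p.2) (𝒯 ×ˢ (univ : Set E)) :=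
    contDiffOn_ymDensityOfBasis_joint_infty b h𝒯 hA
  have hexp_s : ContDiff ℝ ∞ fun p : ℝ × E => Real.exp (Λ * (t - p.1)) :=
    (contDiff_const.mul (contDiff_const.sub contDiff_fst)).exp
  have hw_joint : ContDiffOn ℝ ∞ (fun p : ℝ × E => w p.1 p.2) (𝒯 ×ˢ (univ : Set E)) :=
    hexp_s.contDiffOn.mul he_joint
  have he0 : ∀ s y, 0 ≤ e s y := fun s y => ymDensityOfBasis_nonneg b _ y
  have hw0 : ∀ s ∈ Icc (t - ρ ^ 2) t, ∀ y ∈ closedBall x ρ, 0 ≤ w s y := fun s _ y _ =>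
    mul_nonneg (Real.exp_pos _).le (he0 s y)
  -- ### the subsolution property
  have hsub : ∀ s ∈ Icc (t - ρ ^ 2) t, ∀ y ∈ closedBall x ρ,
      deriv (fun s' => w s' y) s ≤ ∑ i, fderiv ℝ (fun z => fderiv ℝ (w s) z (b i)) y (b i) := by
    intro s hs y hy
    have hs𝒯 : s ∈ 𝒯 := hI hs
    -- Bochner: `∂ₛe − ∑∂∂e ≤ A₃ e √e ≤ Λ e`
    have hB := deriv_ymDensityOfBasis_sub_laplacian_le b h𝒯 hA hpde hs𝒯 (hval hs𝒯) y
    have hN : 0 ≤ ∑ i, ∑ j, ∑ k,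
        ‖covDeriv (A s) (fun z => curvature (A s) z (b j) (b k)) y (b i)‖ ^ 2 := by positivity
    have hey : e s y ≤ M := hbd s hs y hy
    have hsq : Real.sqrt (e s y) ≤ Real.sqrt M := Real.sqrt_le_sqrt hey
    have hB' : deriv (fun s' => e s' y) s -
        ∑ i, fderiv ℝ (fun z => fderiv ℝ (fun z' => e s z') z (b i)) y (b i) ≤ Λ * e s y := by
      refine hB.trans ?_
      calc _ ≤ 0 + A₃ * (e s y * Real.sqrt (e s y)) := by gcongr; linarith
        _ ≤ A₃ * (e s y * Real.sqrt M) := by rw [zero_add]; gcongr; exact he0 s y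
        _ = Λ * e s y := by rw [hΛdef]; ring
    -- the time derivative of `w`
    have hed : HasDerivAt (fun s' => e s' y) (deriv (fun s' => e s' y) s) s :=
      hasDerivAt_ymDensityOfBasis_tslice_of_isOpen b h𝒯 hA hs𝒯 y
    have hexpd : HasDerivAt (fun s' => Real.exp (Λ * (t - s'))) (Real.exp (Λ * (t - s)) * (-Λ)) s := by
      have h : HasDerivAt (fun s' => Λ * (t - s')) (Λ * (0 - 1)) s :=
        ((hasDerivAt_const s t).sub (hasDerivAt_id s)).const_mul Λ
      convert h.exp using 1
      ring
    have hwd : HasDerivAt (fun s' => w s' y)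
        (Real.exp (Λ * (t - s)) * (-Λ) * e s y + Real.exp (Λ * (t - s)) * deriv (fun s' => e s' y) s)
        s := hexpd.mul hed
    rw [hwd.deriv]
    -- the Laplacian of `w s = exp(Λ(t−s)) • e s`
    have he2 : ContDiff ℝ 2 (fun z' => e s z') :=
      (he_joint.comp_contDiff (contDiff_prodMk_right s) fun z => ⟨hs𝒯, mem_univ _⟩).of_le
        (natCast_le_infty₅ 2)
    have hlap : ∑ i, fderiv ℝ (fun z => fderiv ℝ (w s) z (b i)) y (b i) =
        Real.exp (Λ * (t - s)) *
          ∑ i, fderiv ℝ (fun z => fderiv ℝ (fun z' => e s z') z (b i)) y (b i) := by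
      rw [Finset.mul_sum]
      exact Finset.sum_congr rfl fun i _ =>
        Analysis.PDE.fderiv_fderiv_const_mul_apply he2 _ y (b i)
    rw [hlap]
    have hpos : 0 < Real.exp (Λ * (t - s)) := Real.exp_pos _
    nlinarith [hB', mul_le_mul_of_nonneg_left hB' hpos.le]
  -- ### the mean-value inequality for `w`
  have hmv := hMV h𝒯 hw_joint hρ hI hw0 hsub
  have hwt : w t x = e t x := by simp [hw_def]
  rw [hwt, hE] at hmv
  -- ### `∫∫ w ≤ e ∫∫ e`
  have hK : IsCompact (closedBall x ρ) := isCompact_closedBall x ρ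
  have hcont_w : ContinuousOn (fun s => ∫ y in closedBall x ρ, w s y) 𝒯 :=
    continuousOn_setIntegral_of_continuousOn_slab h𝒯 (g := fun p : ℝ × E => w p.1 p.2)
      hw_joint.continuousOn hK Subset.rfl measurableSet_closedBall
  have hcont_e : ContinuousOn (fun s => ∫ y in closedBall x ρ, e s y) 𝒯 :=
    continuousOn_setIntegral_of_continuousOn_slab h𝒯 (g := fun p : ℝ × E => e p.1 p.2)
      he_joint.continuousOn hK Subset.rfl measurableSet_closedBall
  have hle : t - ρ ^ 2 ≤ t := by nlinarith
  have hint_w : IntervalIntegrable (fun s => ∫ y in closedBall x ρ, w s y) volume (t - ρ ^ 2) t :=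
    ContinuousOn.intervalIntegrable (by rw [uIcc_of_le hle]; exact hcont_w.mono hI)
  have hint_e : IntervalIntegrable (fun s => Real.exp 1 * ∫ y in closedBall x ρ, e s y) volume
      (t - ρ ^ 2) t :=
    (ContinuousOn.intervalIntegrable (by rw [uIcc_of_le hle]; exact hcont_e.mono hI)).const_mul _
  have hinner0 : ∀ s, 0 ≤ ∫ y in closedBall x ρ, e s y := fun s =>
    setIntegral_nonneg measurableSet_closedBall fun y _ => he0 s y
  have hcomp : (∫ s in (t - ρ ^ 2)..t, ∫ y in closedBall x ρ, w s y) ≤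
      ∫ s in (t - ρ ^ 2)..t, Real.exp 1 * ∫ y in closedBall x ρ, e s y := by
    refine intervalIntegral.integral_mono_on hle hint_w hint_e fun s hs => ?_
    have hfac : (∫ y in closedBall x ρ, w s y) =
        Real.exp (Λ * (t - s)) * ∫ y in closedBall x ρ, e s y := by
      simp only [hw_def]
      exact MeasureTheory.integral_const_mul _ _
    rw [hfac]
    refine mul_le_mul_of_nonneg_right (Real.exp_le_exp.2 ?_) (hinner0 s)
    calc Λ * (t - s) ≤ Λ * ρ ^ 2 := by gcongr; linarith [hs.1]
      _ ≤ 1 := hΛρ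
  rw [intervalIntegral.integral_const_mul] at hcomp
  have hρ6 : 0 < ρ ^ 6 := by positivity
  calc e t x ≤ C / ρ ^ 6 * ∫ s in (t - ρ ^ 2)..t, ∫ y in closedBall x ρ, w s y := hmv
    _ ≤ C / ρ ^ 6 * (Real.exp 1 * ∫ s in (t - ρ ^ 2)..t, ∫ y in closedBall x ρ, e s y) :=
        mul_le_mul_of_nonneg_left hcomp (by positivity)
    _ = Real.exp 1 * C / ρ ^ 6 * ∫ s in (t - ρ ^ 2)..t, ∫ y in closedBall x ρ, e s y := by ring

omit [FiniteDimensional ℝ E] [MeasurableSpace E] [BorelSpace E] [LinearOrder ι] in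
/-- The index type of an orthonormal basis of a `4`-dimensional space has `4` elements.
[folklore] -/
private theorem card_eq_four_of_finrank (hE : Module.finrank ℝ E = 4) (b : OrthonormalBasis ι ℝ E) :
    (Fintype.card ι : ℝ) = 4 := by
  have h := Module.finrank_eq_card_basis b.toBasis
  rw [hE] at h
  exact_mod_cast h.symm

/-- Slices of the energy density are integrable on balls. [folklore] -/
private theorem integrableOn_ymDensity_ball (b : OrthonormalBasis ι ℝ E)
    {A : ℝ → Connection E (Matrix m m ℂ)} {𝒯 : Set ℝ}
    (he : ContinuousOn (fun p : ℝ × E => ymDensityOfBasis b (A p.1) p.2) (𝒯 ×ˢ (univ : Set E)))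
    {s : ℝ} (hs : s ∈ 𝒯) (x₀ : E) (R : ℝ) :
    IntegrableOn (fun y => ymDensityOfBasis b (A s) y) (ball x₀ R) := by
  have hc : Continuous fun y => ymDensityOfBasis b (A s) y :=
    continuous_slice_of_continuousOn_slab he hs
  exact (hc.continuousOn.integrableOn_compact (isCompact_closedBall x₀ R)).mono_set
    ball_subset_closedBall

/-- **Schoen's trick (Waldron 2019, Prop. 3.1(a), `k = 0`, scale-invariant form).** There are
`ε₀ = ε₀(E, ι) > 0` and `K = K(E, ι)` such that for every jointly smooth `𝔲(m)`-valued solution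
of the Yang–Mills heat equation on an open time set `𝒯 ⊇ [τ − R², τ]` with
`sup_{t ∈ [τ−R², τ]} ∫_{B_R(x₀)} e(t) ≤ ε < ε₀`, one has
`(R − r)⁴ e(t, x) ≤ K ε` whenever `0 ≤ r ≤ R`, `t ∈ [τ − r², τ]`, `|x − x₀| ≤ r`
(maximise `(R − r)⁴ e` over this compact parameter set and apply the mean-value step at the
maximum). [cite: Waldron2019, Prop. 3.1(a) (k = 0); Waldron2016, Prop. 3.2] -/
theorem sup_weighted_ymDensity_le (hE : Module.finrank ℝ E = 4) (b : OrthonormalBasis ι ℝ E) :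
    ∃ ε₀ : ℝ, 0 < ε₀ ∧ ∃ K : ℝ, 0 < K ∧ ∀ {A : ℝ → Connection E (Matrix m m ℂ)} {𝒯 : Set ℝ},
      IsOpen 𝒯 → ContDiffOn ℝ ∞ (fun p : ℝ × E => A p.1 p.2) (𝒯 ×ˢ (univ : Set E)) →
      (∀ ⦃s : ℝ⦄, s ∈ 𝒯 → (A s).IsValuedIn (skewAdjoint.submodule ℝ (Matrix m m ℂ))) →
      (∀ ⦃s : ℝ⦄, s ∈ 𝒯 → ∀ y w, deriv (fun s' => A s' y w) s = divCurvature (A s) y w) →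
      ∀ (x₀ : E) {R : ℝ}, 0 < R → ∀ {τ : ℝ}, Icc (τ - R ^ 2) τ ⊆ 𝒯 →
      ∀ {ε : ℝ}, ε < ε₀ →
      (∀ t ∈ Icc (τ - R ^ 2) τ, ∫ y in ball x₀ R, ymDensityOfBasis b (A t) y ≤ ε) →
      ∀ {r : ℝ}, 0 ≤ r → r ≤ R → ∀ t ∈ Icc (τ - r ^ 2) τ, ∀ x ∈ closedBall x₀ r,
        (R - r) ^ 4 * ymDensityOfBasis b (A t) x ≤ K * ε := by
  obtain ⟨Cm, hCm, hMVs⟩ := ymDensity_le_mul_integral_of_le (m := m) hE b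
  set A₃ : ℝ := 8 * Real.sqrt 2 * (Fintype.card ι : ℝ) ^ 3 with hA₃
  have hA₃pos : 0 < A₃ := by rw [hA₃, card_eq_four_of_finrank hE b]; positivity
  set ε₀ : ℝ := 1 / (16 * A₃ ^ 2 * Cm) with hε₀
  refine ⟨ε₀, by positivity, 16 * Cm, by positivity, ?_⟩
  intro A 𝒯 h𝒯 hA hval hpde x₀ R hR τ hI ε hε hsmall
  have hR2 : 0 < R ^ 2 := by positivity
  set e : ℝ → E → ℝ := fun s y => ymDensityOfBasis b (A s) y with he_def
  have he0 : ∀ s y, 0 ≤ e s y := fun s y => ymDensityOfBasis_nonneg b _ y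
  have he_joint := contDiffOn_ymDensityOfBasis_joint_infty b h𝒯 hA
  have he_cont : ContinuousOn (fun q : ℝ × E => e q.1 q.2) (𝒯 ×ˢ (univ : Set E)) :=
    he_joint.continuousOn
  have hε0 : 0 ≤ ε :=
    (setIntegral_nonneg measurableSet_ball fun y _ => he0 τ y).trans
      (hsmall τ ⟨by linarith, le_rfl⟩)
  -- ### the compact parameter set and the maximiser
  set S : Set (ℝ × ℝ × E) := {p | 0 ≤ p.1 ∧ p.1 ≤ R ∧ τ - p.1 ^ 2 ≤ p.2.1 ∧ p.2.1 ≤ τ ∧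
    dist p.2.2 x₀ ≤ p.1} with hS
  have hSclosed : IsClosed S := by
    have c1 : Continuous fun p : ℝ × ℝ × E => p.1 := continuous_fst
    have c2 : Continuous fun p : ℝ × ℝ × E => p.2.1 := continuous_fst.comp continuous_snd
    have c3 : Continuous fun p : ℝ × ℝ × E => p.2.2 := continuous_snd.comp continuous_snd
    have h1 : IsClosed {p : ℝ × ℝ × E | 0 ≤ p.1} := isClosed_le continuous_const c1
    have h2 : IsClosed {p : ℝ × ℝ × E | p.1 ≤ R} := isClosed_le c1 continuous_const
    have h3 : IsClosed {p : ℝ × ℝ × E | τ - p.1 ^ 2 ≤ p.2.1} :=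
      isClosed_le (continuous_const.sub (c1.pow 2)) c2
    have h4 : IsClosed {p : ℝ × ℝ × E | p.2.1 ≤ τ} := isClosed_le c2 continuous_const
    have h5 : IsClosed {p : ℝ × ℝ × E | dist p.2.2 x₀ ≤ p.1} :=
      isClosed_le (c3.dist continuous_const) c1
    simp only [hS, Set.setOf_and]
    exact h1.inter (h2.inter (h3.inter (h4.inter h5)))
  have hSsub : S ⊆ Icc 0 R ×ˢ (Icc (τ - R ^ 2) τ ×ˢ closedBall x₀ R) := by
    rintro ⟨r, t, x⟩ ⟨hr0, hrR, ht1, ht2, hx⟩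
    have hr2 : r ^ 2 ≤ R ^ 2 := pow_le_pow_left₀ hr0 hrR 2
    exact ⟨⟨hr0, hrR⟩, ⟨by linarith, ht2⟩, mem_closedBall.2 (hx.trans hrR)⟩
  have hScpt : IsCompact S :=
    (isCompact_Icc.prod (isCompact_Icc.prod (isCompact_closedBall x₀ R))).of_isClosed_subset
      hSclosed hSsub
  have hS𝒯 : ∀ p ∈ S, p.2.1 ∈ 𝒯 := fun p hp => hI (hSsub hp).2.1
  set G : ℝ × ℝ × E → ℝ := fun p => (R - p.1) ^ 4 * e p.2.1 p.2.2 with hG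
  have hGc : ContinuousOn G S :=
    ((continuous_const.sub continuous_fst).pow 4).continuousOn.mul
      (he_cont.comp continuous_snd.continuousOn fun p hp => ⟨hS𝒯 p hp, mem_univ _⟩)
  have h0S : ((0 : ℝ), τ, x₀) ∈ S := by
    simp only [hS, mem_setOf_eq]
    exact ⟨le_rfl, hR.le, by simp, le_rfl, by simp⟩
  obtain ⟨p₀, hp₀, hmax⟩ := hScpt.exists_isMaxOn ⟨_, h0S⟩ hGc
  obtain ⟨r₀, t₀, y₀⟩ := p₀
  obtain ⟨hr₀0, hr₀R, ht₀1, ht₀2, hy₀⟩ := hp₀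
  set e₀ : ℝ := e t₀ y₀ with he₀
  have he₀0 : 0 ≤ e₀ := he0 t₀ y₀
  have hGle : ∀ p ∈ S, G p ≤ (R - r₀) ^ 4 * e₀ := fun p hp => hmax hp
  -- ### reduction to the bound at the maximiser
  suffices hkey : (R - r₀) ^ 4 * e₀ ≤ 16 * Cm * ε by
    intro r hr0 hrR t ht x hx
    have hp : (r, t, x) ∈ S := ⟨hr0, hrR, ht.1, ht.2, mem_closedBall.1 hx⟩
    exact (hGle _ hp).trans hkey
  by_cases htriv : r₀ = R ∨ e₀ = 0
  · have h0 : (R - r₀) ^ 4 * e₀ = 0 := by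
      rcases htriv with h | h
      · rw [h, sub_self]; ring
      · rw [h, mul_zero]
    rw [h0]; positivity
  push Not at htriv
  have hr₀R' : r₀ < R := lt_of_le_of_ne hr₀R htriv.1
  have he₀pos : 0 < e₀ := lt_of_le_of_ne he₀0 (Ne.symm htriv.2)
  set ρ₀ : ℝ := (R - r₀) / 2 with hρ₀
  have hρ₀pos : 0 < ρ₀ := by rw [hρ₀]; linarith
  have hRr₀ : R - r₀ = 2 * ρ₀ := by rw [hρ₀]; ring
  -- ### `e ≤ 16 e₀` on the cylinder `Q_{ρ₀}(t₀, y₀)`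
  have hbd16 : ∀ s ∈ Icc (t₀ - ρ₀ ^ 2) t₀, ∀ y ∈ closedBall y₀ ρ₀, e s y ≤ 16 * e₀ := by
    intro s hs y hy
    have hy' : dist y y₀ ≤ ρ₀ := mem_closedBall.1 hy
    have hp : (r₀ + ρ₀, s, y) ∈ S := by
      refine ⟨by positivity, by rw [hρ₀]; linarith, ?_, by linarith [hs.2, ht₀2], ?_⟩
      · show τ - (r₀ + ρ₀) ^ 2 ≤ s
        nlinarith [hs.1, ht₀1, mul_nonneg hr₀0 hρ₀pos.le]
      · show dist y x₀ ≤ r₀ + ρ₀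
        linarith [dist_triangle y y₀ x₀]
    have h := hGle _ hp
    simp only [hG] at h
    rw [show R - (r₀ + ρ₀) = ρ₀ by rw [hρ₀]; ring, hRr₀, mul_pow] at h
    have h' : ρ₀ ^ 4 * e s y ≤ ρ₀ ^ 4 * (16 * e₀) := by nlinarith [h]
    exact le_of_mul_le_mul_left h' (by positivity)
  -- ### the radius `ρ = min(ρ₀, Λ^{-1/2})`, `Λ = A₃ √(16 e₀)`
  set Λ : ℝ := A₃ * Real.sqrt (16 * e₀) with hΛ
  have hΛpos : 0 < Λ := by positivity
  set ρ₁ : ℝ := Real.sqrt (1 / Λ) with hρ₁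
  have hρ₁pos : 0 < ρ₁ := Real.sqrt_pos.2 (by positivity)
  have hρ₁sq : ρ₁ ^ 2 = 1 / Λ := Real.sq_sqrt (by positivity)
  set ρ : ℝ := min ρ₀ ρ₁ with hρ
  have hρpos : 0 < ρ := lt_min hρ₀pos hρ₁pos
  have hρρ₀ : ρ ≤ ρ₀ := min_le_left _ _
  have hρρ₁ : ρ ≤ ρ₁ := min_le_right _ _
  have hΛρ : A₃ * Real.sqrt (16 * e₀) * ρ ^ 2 ≤ 1 := by
    calc A₃ * Real.sqrt (16 * e₀) * ρ ^ 2 = Λ * ρ ^ 2 := by rw [hΛ]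
      _ ≤ Λ * ρ₁ ^ 2 := by gcongr
      _ = 1 := by rw [hρ₁sq]; field_simp
  have hρ2 : ρ ^ 2 ≤ ρ₀ ^ 2 := pow_le_pow_left₀ hρpos.le hρρ₀ 2
  have hsum : r₀ ^ 2 + ρ₀ ^ 2 ≤ R ^ 2 := by
    nlinarith [mul_nonneg hr₀0 hρ₀pos.le, hRr₀]
  have hIρτ : Icc (t₀ - ρ ^ 2) t₀ ⊆ Icc (τ - R ^ 2) τ := fun s hs =>
    ⟨by linarith [hs.1], hs.2.trans ht₀2⟩
  have hIρ : Icc (t₀ - ρ ^ 2) t₀ ⊆ 𝒯 := hIρτ.trans hI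
  have hbdρ : ∀ s ∈ Icc (t₀ - ρ ^ 2) t₀, ∀ y ∈ closedBall y₀ ρ, e s y ≤ 16 * e₀ :=
    fun s hs y hy => hbd16 s ⟨by linarith [hs.1], hs.2⟩ y (closedBall_subset_closedBall hρρ₀ hy)
  -- ### the mean-value step at the maximiser
  have hmv := hMVs h𝒯 hA hval hpde hρpos hIρ (by positivity) hbdρ hΛρ
  -- ### `∫∫_{Q_ρ} e ≤ ρ² ε`
  have hball : closedBall y₀ ρ ⊆ ball x₀ R := fun y hy => mem_ball.2 (by
    have h1 : dist y y₀ ≤ ρ := mem_closedBall.1 hy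
    have h2 : ρ₀ + r₀ < R := by rw [hρ₀]; linarith
    linarith [dist_triangle y y₀ x₀])
  have hinner : ∀ s ∈ Icc (t₀ - ρ ^ 2) t₀, (∫ y in closedBall y₀ ρ, e s y) ≤ ε := by
    intro s hs
    refine (setIntegral_mono_set (integrableOn_ymDensity_ball b he_cont (hIρ hs) x₀ R)
      (ae_of_all _ fun y => he0 s y) hball.eventuallyLE).trans (hsmall s (hIρτ hs))
  have hcontI : ContinuousOn (fun s => ∫ y in closedBall y₀ ρ, e s y) 𝒯 :=
    continuousOn_setIntegral_of_continuousOn_slab h𝒯 (g := fun p : ℝ × E => e p.1 p.2)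
      he_cont (isCompact_closedBall y₀ ρ) Subset.rfl measurableSet_closedBall
  have hleρ : t₀ - ρ ^ 2 ≤ t₀ := by nlinarith
  have hint : IntervalIntegrable (fun s => ∫ y in closedBall y₀ ρ, e s y) volume (t₀ - ρ ^ 2) t₀ :=
    ContinuousOn.intervalIntegrable (by rw [uIcc_of_le hleρ]; exact hcontI.mono hIρ)
  have hII : (∫ s in (t₀ - ρ ^ 2)..t₀, ∫ y in closedBall y₀ ρ, e s y) ≤ ρ ^ 2 * ε := by
    calc (∫ s in (t₀ - ρ ^ 2)..t₀, ∫ y in closedBall y₀ ρ, e s y)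
        ≤ ∫ _s in (t₀ - ρ ^ 2)..t₀, ε :=
          intervalIntegral.integral_mono_on hleρ hint intervalIntegrable_const
            fun s hs => hinner s hs
      _ = ρ ^ 2 * ε := by rw [intervalIntegral.integral_const, smul_eq_mul]; ring
  -- ### `e₀ ρ⁴ ≤ Cm ε`
  have hstar : e₀ * ρ ^ 4 ≤ Cm * ε := by
    have h1 : e₀ ≤ Cm / ρ ^ 6 * (ρ ^ 2 * ε) :=
      hmv.trans (mul_le_mul_of_nonneg_left hII (by positivity))
    have h2 := mul_le_mul_of_nonneg_right h1 (pow_nonneg hρpos.le 4)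
    calc e₀ * ρ ^ 4 ≤ Cm / ρ ^ 6 * (ρ ^ 2 * ε) * ρ ^ 4 := h2
      _ = Cm * ε := by field_simp
  -- ### the two cases for the minimum
  rcases le_total ρ₀ ρ₁ with h01 | h10
  · have hρeq : ρ = ρ₀ := min_eq_left h01
    rw [hρeq] at hstar
    rw [hRr₀, mul_pow]
    nlinarith [hstar]
  · exfalso
    have hρeq : ρ = ρ₁ := min_eq_right h10
    rw [hρeq] at hstar
    have hΛsq : Λ ^ 2 = 16 * A₃ ^ 2 * e₀ := by
      rw [hΛ, mul_pow, Real.sq_sqrt (by positivity)]; ring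
    have hρ₁4 : ρ₁ ^ 4 = 1 / Λ ^ 2 := by
      rw [show (4 : ℕ) = 2 * 2 from rfl, pow_mul, hρ₁sq]; field_simp
    have h1 : e₀ * ρ₁ ^ 4 = 1 / (16 * A₃ ^ 2) := by
      rw [hρ₁4, hΛsq]; field_simp
    have h2 : Cm * ε < Cm * ε₀ := mul_lt_mul_of_pos_left hε hCm
    have h3 : Cm * ε₀ = 1 / (16 * A₃ ^ 2) := by rw [hε₀]; field_simp
    rw [h1] at hstar
    rw [h3] at h2
    exact lt_irrefl _ (hstar.trans_lt h2)

/-- **`ε`-regularity, `k = 0` (Waldron 2019, Prop. 3.1(a); flat setting, proved).** There are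
`ε₀ = ε₀(E, ι) > 0` and `C = C(E, ι)` such that for every jointly smooth `𝔲(m)`-valued solution
`A` of the Yang–Mills heat equation `∂ₜA = div_A F_A` on an open time set `𝒯 ⊇ [τ − R², τ]`
(`R > 0`) with `sup_{t ∈ [τ−R², τ]} ∫_{B_R(x₀)} e(t) ≤ ε < ε₀` (`e = ymDensityOfBasis`, the
`|F|²`-density), for all `t ∈ [τ − R²/2, τ]` and `x ∈ B̄_{R/2}(x₀)`:
`e(t, x) ≤ C R⁻⁶ ∫_{τ−R²}^{τ} ∫_{B_R(x₀)} e` and `e(t, x) ≤ C ε R⁻⁴` — the `k = 0` case of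
`‖F(t)‖_{L^∞(B_{R/2})} ≤ C₀ R⁻³ ‖F‖_{L²(B_R × [τ−R², τ])} ≤ C₀ R⁻² √ε`.
[cite: Waldron2019, Prop. 3.1(a) (k = 0); Waldron2016, Prop. 3.2] -/
theorem Waldron2019_prop_3_1a (hE : Module.finrank ℝ E = 4) (b : OrthonormalBasis ι ℝ E) :
    ∃ ε₀ : ℝ, 0 < ε₀ ∧ ∃ C : ℝ, 0 < C ∧ ∀ {A : ℝ → Connection E (Matrix m m ℂ)} {𝒯 : Set ℝ},
      IsOpen 𝒯 → ContDiffOn ℝ ∞ (fun p : ℝ × E => A p.1 p.2) (𝒯 ×ˢ (univ : Set E)) →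
      (∀ ⦃s : ℝ⦄, s ∈ 𝒯 → (A s).IsValuedIn (skewAdjoint.submodule ℝ (Matrix m m ℂ))) →
      (∀ ⦃s : ℝ⦄, s ∈ 𝒯 → ∀ y w, deriv (fun s' => A s' y w) s = divCurvature (A s) y w) →
      ∀ (x₀ : E) {R : ℝ}, 0 < R → ∀ {τ : ℝ}, Icc (τ - R ^ 2) τ ⊆ 𝒯 →
      ∀ {ε : ℝ}, ε < ε₀ →
      (∀ t ∈ Icc (τ - R ^ 2) τ, ∫ y in ball x₀ R, ymDensityOfBasis b (A t) y ≤ ε) →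
      ∀ t ∈ Icc (τ - R ^ 2 / 2) τ, ∀ x ∈ closedBall x₀ (R / 2),
        ymDensityOfBasis b (A t) x ≤ C / R ^ 6 *
            ∫ s in (τ - R ^ 2)..τ, ∫ y in ball x₀ R, ymDensityOfBasis b (A s) y ∧
        ymDensityOfBasis b (A t) x ≤ C * ε / R ^ 4 := by
  obtain ⟨ε₁, hε₁, K, hK, hSch⟩ := sup_weighted_ymDensity_le (m := m) hE b
  obtain ⟨Cm, hCm, hMVs⟩ := ymDensity_le_mul_integral_of_le (m := m) hE b
  set A₃ : ℝ := 8 * Real.sqrt 2 * (Fintype.card ι : ℝ) ^ 3 with hA₃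
  have hA₃pos : 0 < A₃ := by rw [hA₃, card_eq_four_of_finrank hE b]; positivity
  set ε₀ : ℝ := min ε₁ (1 / (A₃ ^ 2 * K)) with hε₀
  refine ⟨ε₀, lt_min hε₁ (by positivity), 256 * K + Cm * 4 ^ 6, by positivity, ?_⟩
  intro A 𝒯 h𝒯 hA hval hpde x₀ R hR τ hI ε hε hsmall t ht x hx
  have hR2 : 0 < R ^ 2 := by positivity
  have hR4 : 0 < R ^ 4 := by positivity
  set e : ℝ → E → ℝ := fun s y => ymDensityOfBasis b (A s) y with he_def
  have he0 : ∀ s y, 0 ≤ e s y := fun s y => ymDensityOfBasis_nonneg b _ y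
  have he_joint := contDiffOn_ymDensityOfBasis_joint_infty b h𝒯 hA
  have he_cont : ContinuousOn (fun q : ℝ × E => e q.1 q.2) (𝒯 ×ˢ (univ : Set E)) :=
    he_joint.continuousOn
  have hε0 : 0 ≤ ε :=
    (setIntegral_nonneg measurableSet_ball fun y _ => he0 τ y).trans
      (hsmall τ ⟨by linarith, le_rfl⟩)
  have hx' : dist x x₀ ≤ R / 2 := mem_closedBall.1 hx
  -- ### Schoen's trick with `r = 3R/4`: `e ≤ 256 K ε R⁻⁴` on `[τ − 9R²/16, τ] × B̄_{3R/4}(x₀)`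
  have hreg : ∀ s ∈ Icc (τ - (3 * R / 4) ^ 2) τ, ∀ y ∈ closedBall x₀ (3 * R / 4),
      e s y ≤ 256 * K * ε / R ^ 4 := by
    intro s hs y hy
    have h := hSch h𝒯 hA hval hpde x₀ hR hI (lt_of_lt_of_le hε (min_le_left _ _)) hsmall
      (by positivity : (0 : ℝ) ≤ 3 * R / 4) (by linarith : 3 * R / 4 ≤ R) s hs y hy
    rw [show (R - 3 * R / 4) ^ 4 = R ^ 4 / 256 by ring] at h
    rw [le_div_iff₀ hR4]
    linarith
  -- ### the second bound
  have htI : t ∈ Icc (τ - (3 * R / 4) ^ 2) τ := ⟨by nlinarith [ht.1], ht.2⟩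
  have hxI : x ∈ closedBall x₀ (3 * R / 4) := mem_closedBall.2 (by linarith)
  have hsecond : e t x ≤ (256 * K + Cm * 4 ^ 6) * ε / R ^ 4 := by
    refine (hreg t htI x hxI).trans ?_
    rw [div_le_div_iff_of_pos_right hR4]
    nlinarith [hCm.le, hε0]
  refine ⟨?_, hsecond⟩
  -- ### the first bound: the mean-value step at `(t, x)` with `ρ = R/4`
  set ρ : ℝ := R / 4 with hρ
  have hρpos : 0 < ρ := by positivity
  have hIρτ : Icc (t - ρ ^ 2) t ⊆ Icc (τ - R ^ 2) τ := fun s hs =>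
    ⟨by rw [hρ] at hs; nlinarith [hs.1, ht.1], hs.2.trans ht.2⟩
  have hIρ : Icc (t - ρ ^ 2) t ⊆ 𝒯 := hIρτ.trans hI
  set M : ℝ := 256 * K * ε / R ^ 4 with hM
  have hM0 : 0 ≤ M := by positivity
  have hbd : ∀ s ∈ Icc (t - ρ ^ 2) t, ∀ y ∈ closedBall x ρ, e s y ≤ M := by
    intro s hs y hy
    refine hreg s ⟨by rw [hρ] at hs; nlinarith [hs.1, ht.1], hs.2.trans ht.2⟩ y
      (mem_closedBall.2 ?_)
    have h1 : dist y x ≤ R / 4 := mem_closedBall.1 hy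
    linarith [dist_triangle y x x₀]
  have hΛ : A₃ * Real.sqrt M * ρ ^ 2 ≤ 1 := by
    have hsq : Real.sqrt M = 16 * Real.sqrt (K * ε) / R ^ 2 := by
      rw [hM, show 256 * K * ε / R ^ 4 = (16 * Real.sqrt (K * ε) / R ^ 2) ^ 2 by
        rw [div_pow, mul_pow, Real.sq_sqrt (by positivity)]; ring]
      exact Real.sqrt_sq (by positivity)
    have hKε : Real.sqrt (K * ε) ≤ 1 / A₃ := by
      rw [← Real.sqrt_sq (by positivity : (0 : ℝ) ≤ 1 / A₃)]
      refine Real.sqrt_le_sqrt ?_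
      have hε' : ε ≤ 1 / (A₃ ^ 2 * K) := (le_of_lt hε).trans (min_le_right _ _)
      rw [div_pow, one_pow]
      calc K * ε ≤ K * (1 / (A₃ ^ 2 * K)) := by gcongr
        _ = 1 / A₃ ^ 2 := by field_simp
    calc A₃ * Real.sqrt M * ρ ^ 2 = A₃ * Real.sqrt (K * ε) := by
          rw [hsq, hρ]; field_simp; ring
      _ ≤ A₃ * (1 / A₃) := by gcongr
      _ = 1 := by field_simp
  have hmv := hMVs h𝒯 hA hval hpde hρpos hIρ hM0 hbd hΛ
  -- ### comparison of the space-time integrals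
  have hballρ : closedBall x ρ ⊆ ball x₀ R := fun y hy => mem_ball.2 (by
    have h1 : dist y x ≤ R / 4 := mem_closedBall.1 hy
    linarith [dist_triangle y x x₀])
  set F₁ : ℝ → ℝ := fun s => ∫ y in closedBall x ρ, e s y with hF₁
  set F₂ : ℝ → ℝ := fun s => ∫ y in ball x₀ R, e s y with hF₂
  have hF12 : ∀ s ∈ Icc (t - ρ ^ 2) t, F₁ s ≤ F₂ s := fun s hs =>
    setIntegral_mono_set (integrableOn_ymDensity_ball b he_cont (hIρ hs) x₀ R)
      (ae_of_all _ fun y => he0 s y) hballρ.eventuallyLE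
  have hF20 : ∀ s, 0 ≤ F₂ s := fun s => setIntegral_nonneg measurableSet_ball fun y _ => he0 s y
  have hF1c : ContinuousOn F₁ 𝒯 :=
    continuousOn_setIntegral_of_continuousOn_slab h𝒯 (g := fun p : ℝ × E => e p.1 p.2)
      he_cont (isCompact_closedBall x ρ) Subset.rfl measurableSet_closedBall
  have hF2c : ContinuousOn F₂ 𝒯 :=
    continuousOn_setIntegral_of_continuousOn_slab h𝒯 (g := fun p : ℝ × E => e p.1 p.2)
      he_cont (isCompact_closedBall x₀ R) ball_subset_closedBall measurableSet_ball
  have hleρ : t - ρ ^ 2 ≤ t := by nlinarith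
  have hleR : τ - R ^ 2 ≤ τ := by nlinarith
  have hF1i : IntervalIntegrable F₁ volume (t - ρ ^ 2) t :=
    ContinuousOn.intervalIntegrable (by rw [uIcc_of_le hleρ]; exact hF1c.mono hIρ)
  have hF2i : IntervalIntegrable F₂ volume (t - ρ ^ 2) t :=
    ContinuousOn.intervalIntegrable (by rw [uIcc_of_le hleρ]; exact hF2c.mono hIρ)
  have hF2i' : IntervalIntegrable F₂ volume (τ - R ^ 2) τ :=
    ContinuousOn.intervalIntegrable (by rw [uIcc_of_le hleR]; exact hF2c.mono hI)
  have hcomp : (∫ s in (t - ρ ^ 2)..t, F₁ s) ≤ ∫ s in (τ - R ^ 2)..τ, F₂ s :=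
    calc (∫ s in (t - ρ ^ 2)..t, F₁ s) ≤ ∫ s in (t - ρ ^ 2)..t, F₂ s :=
          intervalIntegral.integral_mono_on hleρ hF1i hF2i hF12
      _ ≤ ∫ s in (τ - R ^ 2)..τ, F₂ s := by
          refine intervalIntegral.integral_mono_interval ?_ hleρ ht.2 ?_ hF2i'
          · rw [hρ]; nlinarith [ht.1]
          · exact (ae_restrict_iff' measurableSet_Ioc).2 (ae_of_all _ fun s _ => hF20 s)
  have hI0 : 0 ≤ ∫ s in (τ - R ^ 2)..τ, F₂ s := intervalIntegral.integral_nonneg hleR fun s _ => hF20 s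
  calc e t x ≤ Cm / ρ ^ 6 * ∫ s in (t - ρ ^ 2)..t, F₁ s := hmv
    _ ≤ Cm / ρ ^ 6 * ∫ s in (τ - R ^ 2)..τ, F₂ s := mul_le_mul_of_nonneg_left hcomp (by positivity)
    _ = Cm * 4 ^ 6 / R ^ 6 * ∫ s in (τ - R ^ 2)..τ, F₂ s := by rw [hρ, div_pow]; field_simp
    _ ≤ (256 * K + Cm * 4 ^ 6) / R ^ 6 * ∫ s in (τ - R ^ 2)..τ, F₂ s := by
        refine mul_le_mul_of_nonneg_right ?_ hI0
        rw [div_le_div_iff_of_pos_right (by positivity)]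
        nlinarith [hK.le]

/-! ### Prop. 3.1(b), `k = 0`: the bound for `D^*F` -/

omit [MeasurableSpace E] [BorelSpace E] [LinearOrder ι] in
/-- **Joint smoothness of the Yang–Mills vector field** `(t, y) ↦ div F(t, y)(v)` along a jointly
smooth family on an open time set. [folklore] -/
theorem contDiffOn_divCurvature_joint {A : ℝ → Connection E (Matrix m m ℂ)} {𝒯 : Set ℝ}
    (h𝒯 : IsOpen 𝒯) (hA : ContDiffOn ℝ ∞ (fun p : ℝ × E => A p.1 p.2) (𝒯 ×ˢ (univ : Set E)))
    (v : E) :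
    ContDiffOn ℝ ∞ (fun p : ℝ × E => divCurvature (A p.1) p.2 v) (𝒯 ×ˢ (univ : Set E)) := by
  have hU : IsOpen (𝒯 ×ˢ (univ : Set E)) := h𝒯.prod isOpen_univ
  have hΦ : ∀ i, ContDiffOn ℝ ∞
      (fun p : ℝ × E => curvature (A p.1) p.2 (stdOrthonormalBasis ℝ E i) v)
      (𝒯 ×ˢ (univ : Set E)) := fun i =>
    contDiffOn_curvature_joint hU hA (m := ∞) (by norm_cast) (stdOrthonormalBasis ℝ E i) v
  have hΦ' : ∀ i, ContDiffOn ℝ ∞ (fun p : ℝ × E =>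
      fderiv ℝ (fun p : ℝ × E => curvature (A p.1) p.2 (stdOrthonormalBasis ℝ E i) v) p
        ((0 : ℝ), stdOrthonormalBasis ℝ E i)) (𝒯 ×ˢ (univ : Set E)) := fun i =>
    ((hΦ i).fderiv_of_isOpen hU (m := ∞) (by norm_cast)).clm_apply contDiffOn_const
  have hAi : ∀ i, ContDiffOn ℝ ∞ (fun p : ℝ × E => A p.1 p.2 (stdOrthonormalBasis ℝ E i))
      (𝒯 ×ˢ (univ : Set E)) := fun i => hA.clm_apply contDiffOn_const
  have hbr : ∀ i, ContDiffOn ℝ ∞ (fun p : ℝ × E =>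
      ⁅A p.1 p.2 (stdOrthonormalBasis ℝ E i),
        curvature (A p.1) p.2 (stdOrthonormalBasis ℝ E i) v⁆) (𝒯 ×ˢ (univ : Set E)) := by
    intro i
    have h := ((hAi i).mul (hΦ i)).sub ((hΦ i).mul (hAi i))
    simp only [Ring.lie_def]
    exact h
  have hsum : ContDiffOn ℝ ∞ (fun p : ℝ × E => ∑ i,
      (fderiv ℝ (fun p : ℝ × E => curvature (A p.1) p.2 (stdOrthonormalBasis ℝ E i) v) p
        ((0 : ℝ), stdOrthonormalBasis ℝ E i) +
      ⁅A p.1 p.2 (stdOrthonormalBasis ℝ E i),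
        curvature (A p.1) p.2 (stdOrthonormalBasis ℝ E i) v⁆)) (𝒯 ×ˢ (univ : Set E)) :=
    ContDiffOn.sum fun i _ => (hΦ' i).add (hbr i)
  refine hsum.congr fun p hp => ?_
  obtain ⟨t, y⟩ := p
  change divCurvature (A t) y v = _
  unfold divCurvature covDeriv
  refine Finset.sum_congr rfl fun i _ => ?_
  rw [fderiv_spaceSlice_apply hU (hΦ i) (by simp) hp (stdOrthonormalBasis ℝ E i)]
  rfl

/-- **`ε`-regularity for `D^*F`, `k = 0` (Waldron 2019, Prop. 3.1(b); flat setting, proved).**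
There are `ε₀ = ε₀(E, ι) > 0` and `C = C(E, ι)` such that for every jointly smooth `𝔲(m)`-valued
solution `A` of the Yang–Mills heat equation on an open time set `𝒯 ⊇ [τ − R², τ]` (`R > 0`)
with `sup_{t ∈ [τ−R², τ]} ∫_{B_R(x₀)} e(t) ≤ ε < ε₀`, for all `t ∈ [τ − R²/2, τ]` and
`x ∈ B̄_{R/2}(x₀)`, with `u = ∑ⱼ ‖div F(bⱼ)‖² = |D^*F|²`:
`u(t, x) ≤ C R⁻⁶ ∫_{τ−R²}^{τ} ∫_{B_R(x₀)} u` — the `k = 0` case of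
`‖D^*F(t)‖_{L^∞(B_{R/2})} ≤ C₀ R⁻³ ‖D^*F‖_{L²(B_R × [τ−R², τ])}` (the Bochner inequality for
`|D^*F|²` is linear with coefficient `8√2 (card ι) |F| ≲ √ε R⁻²` by part (a); mean-value
inequality for linear subsolutions). [cite: Waldron2019, Prop. 3.1(b) (k = 0); Waldron2016,
Lemma 3.5] -/
theorem Waldron2019_prop_3_1b (hE : Module.finrank ℝ E = 4) (b : OrthonormalBasis ι ℝ E) :
    ∃ ε₀ : ℝ, 0 < ε₀ ∧ ∃ C : ℝ, 0 < C ∧ ∀ {A : ℝ → Connection E (Matrix m m ℂ)} {𝒯 : Set ℝ},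
      IsOpen 𝒯 → ContDiffOn ℝ ∞ (fun p : ℝ × E => A p.1 p.2) (𝒯 ×ˢ (univ : Set E)) →
      (∀ ⦃s : ℝ⦄, s ∈ 𝒯 → (A s).IsValuedIn (skewAdjoint.submodule ℝ (Matrix m m ℂ))) →
      (∀ ⦃s : ℝ⦄, s ∈ 𝒯 → ∀ y w, deriv (fun s' => A s' y w) s = divCurvature (A s) y w) →
      ∀ (x₀ : E) {R : ℝ}, 0 < R → ∀ {τ : ℝ}, Icc (τ - R ^ 2) τ ⊆ 𝒯 →
      ∀ {ε : ℝ}, ε < ε₀ →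
      (∀ t ∈ Icc (τ - R ^ 2) τ, ∫ y in ball x₀ R, ymDensityOfBasis b (A t) y ≤ ε) →
      ∀ t ∈ Icc (τ - R ^ 2 / 2) τ, ∀ x ∈ closedBall x₀ (R / 2),
        ∑ j, ‖divCurvature (A t) x (b j)‖ ^ 2 ≤ C / R ^ 6 *
          ∫ s in (τ - R ^ 2)..τ, ∫ y in ball x₀ R, ∑ j, ‖divCurvature (A s) y (b j)‖ ^ 2 := by
  obtain ⟨ε₁, hε₁, K, hK, hSch⟩ := sup_weighted_ymDensity_le (m := m) hE b
  obtain ⟨Cl, hCl, hLin⟩ := Analysis.PDE.le_mul_integral_of_linear_subsolution_basis (E := E) b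
  set A₄ : ℝ := 8 * Real.sqrt 2 * (Fintype.card ι : ℝ) with hA₄
  have hA₄pos : 0 < A₄ := by rw [hA₄, card_eq_four_of_finrank hE b]; positivity
  set ε₀ : ℝ := min ε₁ (1 / (A₄ ^ 2 * K)) with hε₀
  refine ⟨ε₀, lt_min hε₁ (by positivity), Cl * 4 ^ 6, by positivity, ?_⟩
  intro A 𝒯 h𝒯 hA hval hpde x₀ R hR τ hI ε hε hsmall t ht x hx
  have hR2 : 0 < R ^ 2 := by positivity
  have hR4 : 0 < R ^ 4 := by positivity
  set e : ℝ → E → ℝ := fun s y => ymDensityOfBasis b (A s) y with he_def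
  have he0 : ∀ s y, 0 ≤ e s y := fun s y => ymDensityOfBasis_nonneg b _ y
  have hε0 : 0 ≤ ε :=
    (setIntegral_nonneg measurableSet_ball fun y _ => he0 τ y).trans
      (hsmall τ ⟨by linarith, le_rfl⟩)
  have hx' : dist x x₀ ≤ R / 2 := mem_closedBall.1 hx
  -- ### part (a): `e ≤ 256 K ε R⁻⁴` on `[τ − 9R²/16, τ] × B̄_{3R/4}(x₀)`
  have hreg : ∀ s ∈ Icc (τ - (3 * R / 4) ^ 2) τ, ∀ y ∈ closedBall x₀ (3 * R / 4),
      e s y ≤ 256 * K * ε / R ^ 4 := by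
    intro s hs y hy
    have h := hSch h𝒯 hA hval hpde x₀ hR hI (lt_of_lt_of_le hε (min_le_left _ _)) hsmall
      (by positivity : (0 : ℝ) ≤ 3 * R / 4) (by linarith : 3 * R / 4 ≤ R) s hs y hy
    rw [show (R - 3 * R / 4) ^ 4 = R ^ 4 / 256 by ring] at h
    rw [le_div_iff₀ hR4]
    linarith
  -- ### the density `u = |D^*F|²`, jointly smooth
  set u : ℝ → E → ℝ := fun s y => ∑ j, ‖divCurvature (A s) y (b j)‖ ^ 2 with hu_def
  have hu0 : ∀ s y, 0 ≤ u s y := fun s y => Finset.sum_nonneg fun j _ => by positivity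
  have hu_joint : ContDiffOn ℝ ∞ (fun p : ℝ × E => u p.1 p.2) (𝒯 ×ˢ (univ : Set E)) :=
    ContDiffOn.sum fun j _ => (contDiffOn_divCurvature_joint h𝒯 hA (b j)).norm_sq ℝ
  have hu_cont : ContinuousOn (fun q : ℝ × E => u q.1 q.2) (𝒯 ×ˢ (univ : Set E)) :=
    hu_joint.continuousOn
  -- ### the mean-value step at `(t, x)` with `ρ = R/4`, `Λ = A₄ √M`
  set ρ : ℝ := R / 4 with hρ
  have hρpos : 0 < ρ := by positivity
  have hIρτ : Icc (t - ρ ^ 2) t ⊆ Icc (τ - R ^ 2) τ := fun s hs =>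
    ⟨by rw [hρ] at hs; nlinarith [hs.1, ht.1], hs.2.trans ht.2⟩
  have hIρ : Icc (t - ρ ^ 2) t ⊆ 𝒯 := hIρτ.trans hI
  set M : ℝ := 256 * K * ε / R ^ 4 with hM
  have hM0 : 0 ≤ M := by positivity
  have hbd : ∀ s ∈ Icc (t - ρ ^ 2) t, ∀ y ∈ closedBall x ρ, e s y ≤ M := by
    intro s hs y hy
    refine hreg s ⟨by rw [hρ] at hs; nlinarith [hs.1, ht.1], hs.2.trans ht.2⟩ y
      (mem_closedBall.2 ?_)
    have h1 : dist y x ≤ R / 4 := mem_closedBall.1 hy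
    linarith [dist_triangle y x x₀]
  set Λ : ℝ := A₄ * Real.sqrt M with hΛ
  have hΛ0 : 0 ≤ Λ := by positivity
  have hΛρ : Λ * ρ ^ 2 ≤ 1 := by
    have hsq : Real.sqrt M = 16 * Real.sqrt (K * ε) / R ^ 2 := by
      rw [hM, show 256 * K * ε / R ^ 4 = (16 * Real.sqrt (K * ε) / R ^ 2) ^ 2 by
        rw [div_pow, mul_pow, Real.sq_sqrt (by positivity)]; ring]
      exact Real.sqrt_sq (by positivity)
    have hKε : Real.sqrt (K * ε) ≤ 1 / A₄ := by
      rw [← Real.sqrt_sq (by positivity : (0 : ℝ) ≤ 1 / A₄)]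
      refine Real.sqrt_le_sqrt ?_
      have hε' : ε ≤ 1 / (A₄ ^ 2 * K) := (le_of_lt hε).trans (min_le_right _ _)
      rw [div_pow, one_pow]
      calc K * ε ≤ K * (1 / (A₄ ^ 2 * K)) := by gcongr
        _ = 1 / A₄ ^ 2 := by field_simp
    calc Λ * ρ ^ 2 = A₄ * Real.sqrt (K * ε) := by rw [hΛ, hsq, hρ]; field_simp; ring
      _ ≤ A₄ * (1 / A₄) := by gcongr
      _ = 1 := by field_simp
  -- the linear subsolution inequality for `u` on the cylinder
  have hsub : ∀ s ∈ Icc (t - ρ ^ 2) t, ∀ y ∈ closedBall x ρ,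
      deriv (fun s' => u s' y) s - ∑ i, fderiv ℝ (fun z => fderiv ℝ (u s) z (b i)) y (b i) ≤
        Λ * u s y := by
    intro s hs y hy
    have hs𝒯 : s ∈ 𝒯 := hIρ hs
    have hB := deriv_divDensity_sub_laplacian_le b h𝒯 hA hval hpde hs𝒯 y
    have hN : 0 ≤ 2 * ∑ i, ∑ j,
        ‖covDeriv (A s) (fun z => divCurvature (A s) z (b j)) y (b i)‖ ^ 2 := by positivity
    have hsq : Real.sqrt (e s y) ≤ Real.sqrt M := Real.sqrt_le_sqrt (hbd s hs y hy)
    have huy : 0 ≤ u s y := hu0 s y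
    calc deriv (fun s' => u s' y) s - ∑ i, fderiv ℝ (fun z => fderiv ℝ (u s) z (b i)) y (b i)
        ≤ -(2 * ∑ i, ∑ j, ‖covDeriv (A s) (fun z => divCurvature (A s) z (b j)) y (b i)‖ ^ 2) +
            A₄ * Real.sqrt (e s y) * u s y := by simpa [hu_def, hA₄, he_def, mul_assoc] using hB
      _ ≤ 0 + A₄ * Real.sqrt M * u s y := by gcongr; linarith
      _ = Λ * u s y := by rw [hΛ, zero_add]
  have hmv := hLin h𝒯 hu_joint hρpos hIρ hΛ0 hΛρ (fun s _ y _ => hu0 s y) hsub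
  rw [hE] at hmv
  -- ### comparison of the space-time integrals
  have hballρ : closedBall x ρ ⊆ ball x₀ R := fun y hy => mem_ball.2 (by
    have h1 : dist y x ≤ R / 4 := mem_closedBall.1 hy
    linarith [dist_triangle y x x₀])
  have huI : ∀ {s : ℝ}, s ∈ 𝒯 → ∀ (c : E) (r : ℝ), IntegrableOn (fun y => u s y) (ball c r) := by
    intro s hs c r
    have hc : Continuous fun y => u s y := continuous_slice_of_continuousOn_slab hu_cont hs
    exact (hc.continuousOn.integrableOn_compact (isCompact_closedBall c r)).mono_set
      ball_subset_closedBall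
  set F₁ : ℝ → ℝ := fun s => ∫ y in closedBall x ρ, u s y with hF₁
  set F₂ : ℝ → ℝ := fun s => ∫ y in ball x₀ R, u s y with hF₂
  have hF12 : ∀ s ∈ Icc (t - ρ ^ 2) t, F₁ s ≤ F₂ s := fun s hs =>
    setIntegral_mono_set (huI (hIρ hs) x₀ R) (ae_of_all _ fun y => hu0 s y) hballρ.eventuallyLE
  have hF20 : ∀ s, 0 ≤ F₂ s := fun s => setIntegral_nonneg measurableSet_ball fun y _ => hu0 s y
  have hF1c : ContinuousOn F₁ 𝒯 :=
    continuousOn_setIntegral_of_continuousOn_slab h𝒯 (g := fun p : ℝ × E => u p.1 p.2)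
      hu_cont (isCompact_closedBall x ρ) Subset.rfl measurableSet_closedBall
  have hF2c : ContinuousOn F₂ 𝒯 :=
    continuousOn_setIntegral_of_continuousOn_slab h𝒯 (g := fun p : ℝ × E => u p.1 p.2)
      hu_cont (isCompact_closedBall x₀ R) ball_subset_closedBall measurableSet_ball
  have hleρ : t - ρ ^ 2 ≤ t := by nlinarith
  have hleR : τ - R ^ 2 ≤ τ := by nlinarith
  have hF1i : IntervalIntegrable F₁ volume (t - ρ ^ 2) t :=
    ContinuousOn.intervalIntegrable (by rw [uIcc_of_le hleρ]; exact hF1c.mono hIρ)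
  have hF2i : IntervalIntegrable F₂ volume (t - ρ ^ 2) t :=
    ContinuousOn.intervalIntegrable (by rw [uIcc_of_le hleρ]; exact hF2c.mono hIρ)
  have hF2i' : IntervalIntegrable F₂ volume (τ - R ^ 2) τ :=
    ContinuousOn.intervalIntegrable (by rw [uIcc_of_le hleR]; exact hF2c.mono hI)
  have hcomp : (∫ s in (t - ρ ^ 2)..t, F₁ s) ≤ ∫ s in (τ - R ^ 2)..τ, F₂ s :=
    calc (∫ s in (t - ρ ^ 2)..t, F₁ s) ≤ ∫ s in (t - ρ ^ 2)..t, F₂ s :=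
          intervalIntegral.integral_mono_on hleρ hF1i hF2i hF12
      _ ≤ ∫ s in (τ - R ^ 2)..τ, F₂ s := by
          refine intervalIntegral.integral_mono_interval ?_ hleρ ht.2 ?_ hF2i'
          · rw [hρ]; nlinarith [ht.1]
          · exact (ae_restrict_iff' measurableSet_Ioc).2 (ae_of_all _ fun s _ => hF20 s)
  have hI0 : 0 ≤ ∫ s in (τ - R ^ 2)..τ, F₂ s := intervalIntegral.integral_nonneg hleR fun s _ => hF20 s
  calc u t x ≤ Cl / ρ ^ (4 + 2) * ∫ s in (t - ρ ^ 2)..t, F₁ s := hmv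
    _ ≤ Cl / ρ ^ (4 + 2) * ∫ s in (τ - R ^ 2)..τ, F₂ s :=
        mul_le_mul_of_nonneg_left hcomp (by positivity)
    _ = Cl * 4 ^ 6 / R ^ 6 * ∫ s in (τ - R ^ 2)..τ, F₂ s := by
        rw [hρ, div_pow, show (4 : ℕ) + 2 = 6 from rfl]; field_simp

/-! ### Lemma 3.2(b) and Lemma 3.3(b), `k = 0` -/

/-- Monotonicity of space-time integrals of a nonnegative slab-continuous integrand in the
domain: `∫_{a₁}^{b₁}∫_{V₁} u ≤ ∫_{a₂}^{b₂}∫_{V₂} u` for `[a₁, b₁] ⊆ [a₂, b₂] ⊆ 𝒯`, `V₁ ⊆ V₂ ⊆ K`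
compact. [folklore] -/
theorem intervalIntegral_setIntegral_mono_of_nonneg {u : ℝ → E → ℝ} {𝒯 : Set ℝ}
    (h𝒯 : IsOpen 𝒯) (hu : ContinuousOn (fun p : ℝ × E => u p.1 p.2) (𝒯 ×ˢ (univ : Set E)))
    (hu0 : ∀ s y, 0 ≤ u s y) {V₁ V₂ K : Set E} (hK : IsCompact K) (h12 : V₁ ⊆ V₂) (h2K : V₂ ⊆ K)
    (hV₁ : MeasurableSet V₁) (hV₂ : MeasurableSet V₂) {a₁ b₁ a₂ b₂ : ℝ} (ha : a₂ ≤ a₁)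
    (hab : a₁ ≤ b₁) (hb : b₁ ≤ b₂) (hI : Icc a₂ b₂ ⊆ 𝒯) :
    (∫ s in a₁..b₁, ∫ y in V₁, u s y) ≤ ∫ s in a₂..b₂, ∫ y in V₂, u s y := by
  have hI₁ : Icc a₁ b₁ ⊆ 𝒯 := fun s hs => hI ⟨ha.trans hs.1, hs.2.trans hb⟩
  have huI : ∀ {s : ℝ}, s ∈ 𝒯 → IntegrableOn (fun y => u s y) V₂ := by
    intro s hs
    have hc : Continuous fun y => u s y := continuous_slice_of_continuousOn_slab hu hs
    exact (hc.continuousOn.integrableOn_compact hK).mono_set h2K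
  set F₁ : ℝ → ℝ := fun s => ∫ y in V₁, u s y with hF₁
  set F₂ : ℝ → ℝ := fun s => ∫ y in V₂, u s y with hF₂
  have hF12 : ∀ s ∈ Icc a₁ b₁, F₁ s ≤ F₂ s := fun s hs =>
    setIntegral_mono_set (huI (hI₁ hs)) (ae_of_all _ fun y => hu0 s y) h12.eventuallyLE
  have hF20 : ∀ s, 0 ≤ F₂ s := fun s => setIntegral_nonneg hV₂ fun y _ => hu0 s y
  have hF1c : ContinuousOn F₁ 𝒯 :=
    continuousOn_setIntegral_of_continuousOn_slab h𝒯 (g := fun p : ℝ × E => u p.1 p.2)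
      hu hK (h12.trans h2K) hV₁
  have hF2c : ContinuousOn F₂ 𝒯 :=
    continuousOn_setIntegral_of_continuousOn_slab h𝒯 (g := fun p : ℝ × E => u p.1 p.2)
      hu hK h2K hV₂
  have hF1i : IntervalIntegrable F₁ volume a₁ b₁ :=
    ContinuousOn.intervalIntegrable (by rw [uIcc_of_le hab]; exact hF1c.mono hI₁)
  have hF2i : IntervalIntegrable F₂ volume a₁ b₁ :=
    ContinuousOn.intervalIntegrable (by rw [uIcc_of_le hab]; exact hF2c.mono hI₁)
  have hF2i' : IntervalIntegrable F₂ volume a₂ b₂ :=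
    ContinuousOn.intervalIntegrable (by rw [uIcc_of_le (ha.trans (hab.trans hb))]; exact hF2c.mono hI)
  calc (∫ s in a₁..b₁, F₁ s) ≤ ∫ s in a₁..b₁, F₂ s :=
        intervalIntegral.integral_mono_on hab hF1i hF2i hF12
    _ ≤ ∫ s in a₂..b₂, F₂ s := by
        refine intervalIntegral.integral_mono_interval ha hab hb ?_ hF2i'
        exact (ae_restrict_iff' measurableSet_Ioc).2 (ae_of_all _ fun s _ => hF20 s)

/-- **Local energy comparison with a general inner radius** (the second inequality of Waldron's
Lemma 3.2(a), cut-off for `B_r ⊂ B_R`): under `sup_{[t₀,τ]} ‖F‖²_{L²(B_R)} ≤ E`,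
`‖D^*F‖²_{L²(B_R × [t₀,τ])} ≤ δ²`, for `0 < r < R` and `t₀ ≤ t ≤ τ`,
`‖F(t)‖²_{L²(B_r)} ≤ ‖F(τ)‖²_{L²(B_R)} + 2δ(δ + c√((τ−t₀)E)/(R − r))`.
[cite: Waldron2019, Lemma 3.2 (a)] -/
theorem Waldron2019_lemma_3_2a_inner (b : OrthonormalBasis ι ℝ E) :
    ∃ c : ℝ, 0 ≤ c ∧ ∀ {A : ℝ → Connection E (Matrix m m ℂ)} {𝒯 : Set ℝ}, IsOpen 𝒯 →
      ContDiffOn ℝ ∞ (fun p : ℝ × E => A p.1 p.2) (𝒯 ×ˢ (univ : Set E)) →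
      (∀ ⦃s : ℝ⦄, s ∈ 𝒯 → (A s).IsValuedIn (skewAdjoint.submodule ℝ (Matrix m m ℂ))) →
      (∀ ⦃s : ℝ⦄, s ∈ 𝒯 → ∀ y w, deriv (fun s' => A s' y w) s = divCurvature (A s) y w) →
      ∀ (x₀ : E) {r R : ℝ}, 0 < r → r < R → ∀ {t₀ τ : ℝ}, Icc t₀ τ ⊆ 𝒯 → ∀ {En δ : ℝ}, 0 ≤ En →
      (∀ s ∈ Icc t₀ τ, ∫ y in ball x₀ R, ymDensityOfBasis b (A s) y ≤ En) → 0 ≤ δ →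
      (∫ s in t₀..τ, ∫ y in ball x₀ R, ∑ j, ‖divCurvature (A s) y (b j)‖ ^ 2 ≤ δ ^ 2) →
      ∀ t ∈ Icc t₀ τ,
        ∫ y in ball x₀ r, ymDensityOfBasis b (A t) y ≤
          (∫ y in ball x₀ R, ymDensityOfBasis b (A τ) y) +
            2 * δ * (δ + c * Real.sqrt ((τ - t₀) * En) / (R - r)) := by
  obtain ⟨M, hM0, hrad⟩ := Literature.Analysis.Calculus.exists_radial_cutoff_gradient_le (E := E)
  refine ⟨Real.sqrt 2 * M, by positivity, ?_⟩
  intro A 𝒯 h𝒯 hA hval hpde x₀ r R hr hrR t₀ τ hsub En δ hEn0 hEn hδ0 hδ t ht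
  obtain ⟨φ, hφs, hφ0, hφ1, hone, hzero, hφcs, hgrad⟩ := hrad x₀ r R hr hrR
  have hφC1 : ContDiff ℝ 1 φ := hφs.of_le (natCast_le_infty₅ 1)
  have hφ01 : ∀ y, 0 ≤ φ y ∧ φ y ≤ 1 := fun y => ⟨hφ0 y, hφ1 y⟩
  have hφV : ∀ y ∉ ball x₀ R, φ y = 0 := fun y hy => hzero y (not_lt.mp (mt mem_ball.mpr hy))
  have hRr : 0 < R - r := sub_pos.2 hrR
  have hcomp := abs_weightedEnergy_sub_le_of_flow_on b h𝒯 hA hval hpde hφC1 hφcs hφ01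
    measurableSet_ball isBounded_ball hφV (by positivity) hgrad hsub hEn0 hEn hδ0 hδ ht
  have hγ : 2 * δ * (δ + Real.sqrt 2 * (M / (R - r)) * Real.sqrt ((τ - t₀) * En)) =
      2 * δ * (δ + Real.sqrt 2 * M * Real.sqrt ((τ - t₀) * En) / (R - r)) := by
    field_simp
  rw [hγ] at hcomp
  have hτ : τ ∈ 𝒯 := hsub ⟨ht.1.trans ht.2, le_rfl⟩
  have ht𝒯 : t ∈ 𝒯 := hsub ht
  have he_c : ContinuousOn (fun p : ℝ × E => ymDensityOfBasis b (A p.1) p.2) (𝒯 ×ˢ univ) :=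
    (contDiffOn_ymDensityOfBasis_joint_infty b h𝒯 hA).continuousOn
  have heτ : Continuous fun y => ymDensityOfBasis b (A τ) y :=
    continuous_slice_of_continuousOn_slab he_c hτ
  have het : Continuous fun y => ymDensityOfBasis b (A t) y :=
    continuous_slice_of_continuousOn_slab he_c ht𝒯
  have hone' : ∀ y ∈ ball x₀ r, φ y = 1 := fun y hy => hone y (mem_ball.mp hy).le
  exact setIntegral_le_setIntegral_add_of_weighted_sub_le hφs.continuous hφcs hφ01
    measurableSet_ball measurableSet_ball isBounded_ball hone' hφV het heτ
    (fun y => ymDensityOfBasis_nonneg b _ y) (fun y => ymDensityOfBasis_nonneg b _ y)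
    (by rw [abs_sub_comm] at hcomp; exact le_abs_self _ |>.trans hcomp)

/-- **Waldron's Lemma 3.2 (b), `k = 0`** (flat setting, proved). There are `ε₀ > 0`, `c ≥ 0`
and `C` such that: under `sup_{[t₀,τ]}‖F‖²_{L²(B_R)} ≤ E`, `‖D^*F‖²_{L²(B_R × [t₀,τ])} ≤ δ²` and
`‖F(τ)‖²_{L²(B_R)} + γ ≤ ε < ε₀`, `γ = 2δ(δ + c√((τ−t₀)E)/R)`, one has for `t₀ + R² ≤ t ≤ τ` and
`x ∈ B̄_{R/2}(x₀)`: `|F(t,x)|²`-density `e(t, x) ≤ C ε R⁻⁴` and `|D^*F(t,x)|² ≤ C δ² R⁻⁶`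
(the `k = 0` case of `‖F(t)‖_{L^∞(B_{R/2})} ≤ C R⁻²√ε`, `‖D^*F(t)‖_{L^∞(B_{R/2})} ≤ C R⁻³δ`:
local energy comparison for `B_{3R/4} ⊂ B_R`, then Prop. 3.1 on `B_{R/4}(x)`).
[cite: Waldron2019, Lemma 3.2 (b) (k = 0)] -/
theorem Waldron2019_lemma_3_2b (hE : Module.finrank ℝ E = 4) (b : OrthonormalBasis ι ℝ E) :
    ∃ ε₀ : ℝ, 0 < ε₀ ∧ ∃ c : ℝ, 0 ≤ c ∧ ∃ C : ℝ, 0 < C ∧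
      ∀ {A : ℝ → Connection E (Matrix m m ℂ)} {𝒯 : Set ℝ}, IsOpen 𝒯 →
      ContDiffOn ℝ ∞ (fun p : ℝ × E => A p.1 p.2) (𝒯 ×ˢ (univ : Set E)) →
      (∀ ⦃s : ℝ⦄, s ∈ 𝒯 → (A s).IsValuedIn (skewAdjoint.submodule ℝ (Matrix m m ℂ))) →
      (∀ ⦃s : ℝ⦄, s ∈ 𝒯 → ∀ y w, deriv (fun s' => A s' y w) s = divCurvature (A s) y w) →
      ∀ (x₀ : E) {R : ℝ}, 0 < R → ∀ {t₀ τ : ℝ}, Icc t₀ τ ⊆ 𝒯 → ∀ {En δ : ℝ}, 0 ≤ En →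
      (∀ s ∈ Icc t₀ τ, ∫ y in ball x₀ R, ymDensityOfBasis b (A s) y ≤ En) → 0 ≤ δ →
      (∫ s in t₀..τ, ∫ y in ball x₀ R, ∑ j, ‖divCurvature (A s) y (b j)‖ ^ 2 ≤ δ ^ 2) →
      ∀ {ε : ℝ}, ε < ε₀ →
      (∫ y in ball x₀ R, ymDensityOfBasis b (A τ) y) +
          2 * δ * (δ + c * Real.sqrt ((τ - t₀) * En) / R) ≤ ε →
      ∀ t ∈ Icc (t₀ + R ^ 2) τ, ∀ x ∈ closedBall x₀ (R / 2),
        ymDensityOfBasis b (A t) x ≤ C * ε / R ^ 4 ∧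
        ∑ j, ‖divCurvature (A t) x (b j)‖ ^ 2 ≤ C * δ ^ 2 / R ^ 6 := by
  obtain ⟨εa, hεa, Ca, hCa, hPa⟩ := Waldron2019_prop_3_1a (m := m) hE b
  obtain ⟨εb, hεb, Cb, hCb, hPb⟩ := Waldron2019_prop_3_1b (m := m) hE b
  obtain ⟨c₀, hc₀, hcomp⟩ := Waldron2019_lemma_3_2a_inner (m := m) b
  refine ⟨min εa εb, lt_min hεa hεb, 4 * c₀, by positivity, 256 * Ca + 4 ^ 6 * Cb, by positivity, ?_⟩
  intro A 𝒯 h𝒯 hA hval hpde x₀ R hR t₀ τ hI En δ hEn0 hEn hδ0 hδ ε hε hsmall t ht x hx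
  have hR2 : 0 < R ^ 2 := by positivity
  have hx' : dist x x₀ ≤ R / 2 := mem_closedBall.1 hx
  set e : ℝ → E → ℝ := fun s y => ymDensityOfBasis b (A s) y with he_def
  have he0 : ∀ s y, 0 ≤ e s y := fun s y => ymDensityOfBasis_nonneg b _ y
  have he_cont : ContinuousOn (fun q : ℝ × E => e q.1 q.2) (𝒯 ×ˢ (univ : Set E)) :=
    (contDiffOn_ymDensityOfBasis_joint_infty b h𝒯 hA).continuousOn
  set u : ℝ → E → ℝ := fun s y => ∑ j, ‖divCurvature (A s) y (b j)‖ ^ 2 with hu_def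
  have hu0 : ∀ s y, 0 ≤ u s y := fun s y => Finset.sum_nonneg fun j _ => by positivity
  have hu_cont : ContinuousOn (fun q : ℝ × E => u q.1 q.2) (𝒯 ×ˢ (univ : Set E)) :=
    (ContDiffOn.sum fun j _ => (contDiffOn_divCurvature_joint h𝒯 hA (b j)).norm_sq ℝ).continuousOn
  -- ### smallness on `B_{3R/4}` at all times, then on `B_{R/4}(x)`
  have h34 : ∀ s ∈ Icc t₀ τ, (∫ y in ball x₀ (3 * R / 4), e s y) ≤ ε := by
    intro s hs
    have h := hcomp h𝒯 hA hval hpde x₀ (by positivity : (0 : ℝ) < 3 * R / 4) (by linarith) hI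
      hEn0 hEn hδ0 hδ s hs
    rw [show R - 3 * R / 4 = R / 4 by ring, div_div_eq_mul_div] at h
    have h4 : 2 * δ * (δ + c₀ * Real.sqrt ((τ - t₀) * En) * 4 / R) =
        2 * δ * (δ + 4 * c₀ * Real.sqrt ((τ - t₀) * En) / R) := by ring
    rw [h4] at h
    exact h.trans hsmall
  set ρ : ℝ := R / 4 with hρ
  have hρpos : 0 < ρ := by positivity
  have hball : ball x ρ ⊆ ball x₀ (3 * R / 4) := fun y hy => mem_ball.2 (by
    have h1 : dist y x < R / 4 := mem_ball.1 hy
    linarith [dist_triangle y x x₀])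
  have hballR : ball x ρ ⊆ ball x₀ R := hball.trans (ball_subset_ball (by linarith))
  have hIρ : Icc (t - ρ ^ 2) t ⊆ Icc t₀ τ := fun s hs =>
    ⟨by rw [hρ] at hs; nlinarith [hs.1, ht.1], hs.2.trans ht.2⟩
  have hIρ𝒯 : Icc (t - ρ ^ 2) t ⊆ 𝒯 := hIρ.trans hI
  have hsmallρ : ∀ s ∈ Icc (t - ρ ^ 2) t, (∫ y in ball x ρ, e s y) ≤ ε := by
    intro s hs
    have hs𝒯 : s ∈ 𝒯 := hIρ𝒯 hs
    have hc : Continuous fun y => e s y := continuous_slice_of_continuousOn_slab he_cont hs𝒯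
    refine (setIntegral_mono_set ((hc.continuousOn.integrableOn_compact
      (isCompact_closedBall x₀ (3 * R / 4))).mono_set ball_subset_closedBall)
      (ae_of_all _ fun y => he0 s y) hball.eventuallyLE).trans (h34 s (hIρ hs))
  have htI : t ∈ Icc (t - ρ ^ 2 / 2) t := ⟨by nlinarith, le_rfl⟩
  have hxI : x ∈ closedBall x (ρ / 2) := mem_closedBall.2 (by rw [dist_self]; positivity)
  constructor
  · -- the curvature bound from Prop. 3.1(a)
    have h := (hPa h𝒯 hA hval hpde x hρpos hIρ𝒯 (lt_of_lt_of_le hε (min_le_left _ _))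
      hsmallρ t htI x hxI).2
    calc e t x ≤ Ca * ε / ρ ^ 4 := h
      _ = 256 * Ca * ε / R ^ 4 := by rw [hρ]; field_simp; ring
      _ ≤ (256 * Ca + 4 ^ 6 * Cb) * ε / R ^ 4 := by
          have hε0 : 0 ≤ ε := (setIntegral_nonneg measurableSet_ball fun y _ => he0 t y).trans
            (hsmallρ t ⟨by nlinarith, le_rfl⟩)
          rw [div_le_div_iff_of_pos_right (by positivity)]
          nlinarith [hCb.le]
  · -- the `D^*F` bound from Prop. 3.1(b)
    have h := hPb h𝒯 hA hval hpde x hρpos hIρ𝒯 (lt_of_lt_of_le hε (min_le_right _ _))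
      hsmallρ t htI x hxI
    have hmono : (∫ s in (t - ρ ^ 2)..t, ∫ y in ball x ρ, u s y) ≤ δ ^ 2 :=
      (intervalIntegral_setIntegral_mono_of_nonneg h𝒯 hu_cont hu0 (isCompact_closedBall x₀ R)
        hballR ball_subset_closedBall measurableSet_ball measurableSet_ball
        (hIρ ⟨le_rfl, by nlinarith⟩).1 (by nlinarith) ht.2 hI).trans hδ
    calc u t x ≤ Cb / ρ ^ 6 * ∫ s in (t - ρ ^ 2)..t, ∫ y in ball x ρ, u s y := h
      _ ≤ Cb / ρ ^ 6 * δ ^ 2 := mul_le_mul_of_nonneg_left hmono (by positivity)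
      _ = 4 ^ 6 * Cb * δ ^ 2 / R ^ 6 := by rw [hρ]; field_simp
      _ ≤ (256 * Ca + 4 ^ 6 * Cb) * δ ^ 2 / R ^ 6 := by
          rw [div_le_div_iff_of_pos_right (by positivity)]
          nlinarith [hCa.le, sq_nonneg δ]

/-- **Waldron's Lemma 3.3 (b), `k = 0`** (flat setting, proved). With `½ ≤ α < 1`,
`U₁ = B̄_R ∖ B_{αR}`, `U₂ = B̄_{R/α} ∖ B_{α²R}`: there are `ε₀ > 0`, `c ≥ 0`, `C` such that under
`sup_{[t₀,τ]}‖F‖²_{L²(U₂)} ≤ E`, `‖D^*F‖²_{L²(U₂ × [t₀,τ])} ≤ δ²` and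
`‖F(τ)‖²_{L²(U₂)} + γ ≤ ε < ε₀`, `γ = 2δ(δ + c√((τ−t₀)E)/((1−α)R))`, for `t₀ + R² ≤ t ≤ τ`
and `x ∈ U₁`: `e(t, x) ≤ C ε /((α(1−α))⁴R⁴)` and `|D^*F(t,x)|² ≤ C δ²/((α(1−α))⁶R⁶)`
(the `k = 0` case of `‖F(t)‖_{L^∞(U₁)} ≤ C_α R⁻²√ε`, `‖D^*F(t)‖_{L^∞(U₁)} ≤ C_α R⁻³δ`:
annular energy comparison for an intermediate annulus `U' ⋐ U₂`, then Prop. 3.1 on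
`B_ρ(x) ⊂ U'`, `ρ = α(1−α)R/4`). [cite: Waldron2019, Lemma 3.3 (b) (k = 0)] -/
theorem Waldron2019_lemma_3_3b (hE : Module.finrank ℝ E = 4) (b : OrthonormalBasis ι ℝ E) :
    ∃ ε₀ : ℝ, 0 < ε₀ ∧ ∃ c : ℝ, 0 ≤ c ∧ ∃ C : ℝ, 0 < C ∧
      ∀ {A : ℝ → Connection E (Matrix m m ℂ)} {𝒯 : Set ℝ}, IsOpen 𝒯 →
      ContDiffOn ℝ ∞ (fun p : ℝ × E => A p.1 p.2) (𝒯 ×ˢ (univ : Set E)) →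
      (∀ ⦃s : ℝ⦄, s ∈ 𝒯 → (A s).IsValuedIn (skewAdjoint.submodule ℝ (Matrix m m ℂ))) →
      (∀ ⦃s : ℝ⦄, s ∈ 𝒯 → ∀ y w, deriv (fun s' => A s' y w) s = divCurvature (A s) y w) →
      ∀ (x₀ : E) {R α : ℝ}, 0 < R → 1 / 2 ≤ α → α < 1 → ∀ {t₀ τ : ℝ}, Icc t₀ τ ⊆ 𝒯 →
      ∀ {En δ : ℝ}, 0 ≤ En →
      (∀ s ∈ Icc t₀ τ, ∫ y in closedBall x₀ (R / α) \ ball x₀ (α ^ 2 * R),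
        ymDensityOfBasis b (A s) y ≤ En) → 0 ≤ δ →
      (∫ s in t₀..τ, ∫ y in closedBall x₀ (R / α) \ ball x₀ (α ^ 2 * R),
        ∑ j, ‖divCurvature (A s) y (b j)‖ ^ 2 ≤ δ ^ 2) →
      ∀ {ε : ℝ}, ε < ε₀ →
      (∫ y in closedBall x₀ (R / α) \ ball x₀ (α ^ 2 * R), ymDensityOfBasis b (A τ) y) +
          2 * δ * (δ + c * Real.sqrt ((τ - t₀) * En) / ((1 - α) * R)) ≤ ε →
      ∀ t ∈ Icc (t₀ + R ^ 2) τ, ∀ x ∈ closedBall x₀ R \ ball x₀ (α * R),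
        ymDensityOfBasis b (A t) x ≤ C * ε / ((α * (1 - α)) ^ 4 * R ^ 4) ∧
        ∑ j, ‖divCurvature (A t) x (b j)‖ ^ 2 ≤ C * δ ^ 2 / ((α * (1 - α)) ^ 6 * R ^ 6) := by
  obtain ⟨εa, hεa, Ca, hCa, hPa⟩ := Waldron2019_prop_3_1a (m := m) hE b
  obtain ⟨εb, hεb, Cb, hCb, hPb⟩ := Waldron2019_prop_3_1b (m := m) hE b
  obtain ⟨M, hM0, hann⟩ := Literature.Analysis.Calculus.exists_annular_cutoff_gradient_le (E := E)
  refine ⟨min εa εb, lt_min hεa hεb, 8 * Real.sqrt 2 * M, by positivity, 4 ^ 4 * Ca + 4 ^ 6 * Cb,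
    by positivity, ?_⟩
  intro A 𝒯 h𝒯 hA hval hpde x₀ R α hR hα hα1 t₀ τ hI En δ hEn0 hEn hδ0 hδ ε hε hsmall t ht x hx
  have hα0 : 0 < α := by linarith
  have h1α : 0 < 1 - α := by linarith
  have hαR : 0 < α * (1 - α) * R := by positivity
  have he0 : ∀ s y, 0 ≤ ymDensityOfBasis b (A s) y := fun s y => ymDensityOfBasis_nonneg b _ y
  have he_cont : ContinuousOn (fun q : ℝ × E => ymDensityOfBasis b (A q.1) q.2) (𝒯 ×ˢ (univ : Set E)) :=
    (contDiffOn_ymDensityOfBasis_joint_infty b h𝒯 hA).continuousOn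
  have hu0 : ∀ s y, 0 ≤ (∑ j, ‖divCurvature (A s) y (b j)‖ ^ 2) := fun s y => Finset.sum_nonneg fun j _ => by positivity
  have hu_cont : ContinuousOn (fun q : ℝ × E => (∑ j, ‖divCurvature (A q.1) q.2 (b j)‖ ^ 2)) (𝒯 ×ˢ (univ : Set E)) :=
    (ContDiffOn.sum fun j _ => (contDiffOn_divCurvature_joint h𝒯 hA (b j)).norm_sq ℝ).continuousOn
  -- ### the intermediate annulus `U'` and its cut-off
  set ρ₁ : ℝ := α * (1 + α) * R / 2 with hρ₁
  set ρ₂ : ℝ := (1 + α) * R / (2 * α) with hρ₂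
  set U₂ : Set E := closedBall x₀ (R / α) \ ball x₀ (α ^ 2 * R) with hU₂
  set U' : Set E := closedBall x₀ ρ₂ \ ball x₀ ρ₁ with hU'
  have hr1 : α ^ 2 * R < ρ₁ := by rw [hρ₁]; nlinarith
  have hr12 : ρ₁ ≤ ρ₂ := by
    rw [hρ₁, hρ₂, div_le_div_iff₀ (by norm_num) (by positivity)]
    nlinarith [mul_pos hR h1α, sq_nonneg α]
  have hr2 : ρ₂ < R / α := by
    rw [hρ₂, div_lt_div_iff₀ (by positivity) hα0]
    nlinarith [mul_pos hR h1α]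
  obtain ⟨φ, hφs, hφ0, hφ1, hone, hzin, hzout, hφcs, hgrad⟩ := hann x₀ (α ^ 2 * R) ρ₁ ρ₂ (R / α)
    (by positivity) hr1 hr12 hr2
  have hφC1 : ContDiff ℝ 1 φ := hφs.of_le (natCast_le_infty₅ 1)
  have hφ01 : ∀ y, 0 ≤ φ y ∧ φ y ≤ 1 := fun y => ⟨hφ0 y, hφ1 y⟩
  have hU₂m : MeasurableSet U₂ := measurableSet_closedBall.diff measurableSet_ball
  have hU'm : MeasurableSet U' := measurableSet_closedBall.diff measurableSet_ball
  have hU₂b : Bornology.IsBounded U₂ := isBounded_closedBall.subset fun _ hy => hy.1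
  have hφV : ∀ y ∉ U₂, φ y = 0 := by
    intro y hy
    by_cases h1 : dist y x₀ ≤ R / α
    · have h2 : dist y x₀ < α ^ 2 * R := by
        by_contra h2
        exact hy ⟨mem_closedBall.mpr h1, fun hb => h2 (mem_ball.mp hb)⟩
      exact hzin y h2.le
    · exact hzout y (le_of_lt (not_le.mp h1))
  have hone' : ∀ y ∈ U', φ y = 1 := fun y hy =>
    hone y (not_lt.1 fun h => hy.2 (mem_ball.2 h)) (mem_closedBall.1 hy.1)
  -- the gradient bound `‖Dφ‖ ≤ 4M/(α(1−α)R)`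
  have hK : ∀ y, ‖fderiv ℝ φ y‖ ≤ 4 * M / (α * (1 - α) * R) := fun y => by
    refine (hgrad y).trans ?_
    have e1 : ρ₁ - α ^ 2 * R = α * (1 - α) * R / 2 := by rw [hρ₁]; ring
    have e2 : R / α - ρ₂ = (1 - α) * R / (2 * α) := by rw [hρ₂]; field_simp; ring
    rw [e1, e2, div_div_eq_mul_div, div_div_eq_mul_div]
    have h2 : M * (2 * α) / ((1 - α) * R) ≤ M * 2 / (α * (1 - α) * R) := by
      rw [div_le_div_iff₀ (by positivity) (by positivity)]
      have : α * α ≤ 1 := by nlinarith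
      nlinarith [mul_nonneg hM0 (mul_pos h1α hR).le]
    calc M * 2 / (α * (1 - α) * R) + M * (2 * α) / ((1 - α) * R)
        ≤ M * 2 / (α * (1 - α) * R) + M * 2 / (α * (1 - α) * R) := by linarith
      _ = 4 * M / (α * (1 - α) * R) := by ring
  -- ### the comparison `∫_{U'} e(s) ≤ ∫_{U₂} e(τ) + γ ≤ ε` for all `s ∈ [t₀, τ]`
  have hτ : τ ∈ 𝒯 := hI ⟨by linarith [ht.1, ht.2, sq_nonneg R], le_rfl⟩
  have hU'small : ∀ s ∈ Icc t₀ τ, (∫ y in U', ymDensityOfBasis b (A s) y) ≤ ε := by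
    intro s hs
    have hcomp := abs_weightedEnergy_sub_le_of_flow_on b h𝒯 hA hval hpde hφC1 hφcs hφ01
      hU₂m hU₂b hφV (by positivity) hK hI hEn0 hEn hδ0 hδ hs
    have hs𝒯 : s ∈ 𝒯 := hI hs
    have heτ : Continuous fun y => ymDensityOfBasis b (A τ) y := continuous_slice_of_continuousOn_slab he_cont hτ
    have hes : Continuous fun y => ymDensityOfBasis b (A s) y := continuous_slice_of_continuousOn_slab he_cont hs𝒯
    have hdiff : (∫ y, φ y * ymDensityOfBasis b (A s) y) - ∫ y, φ y * ymDensityOfBasis b (A τ) y ≤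
        2 * δ * (δ + Real.sqrt 2 * (4 * M / (α * (1 - α) * R)) * Real.sqrt ((τ - t₀) * En)) := by
      rw [abs_sub_comm] at hcomp
      exact (le_abs_self _).trans hcomp
    have h1 := setIntegral_le_setIntegral_add_of_weighted_sub_le hφs.continuous hφcs hφ01
      hU'm hU₂m hU₂b hone' hφV hes heτ (fun y => he0 s y) (fun y => he0 τ y) hdiff
    have hS : 0 ≤ Real.sqrt ((τ - t₀) * En) := Real.sqrt_nonneg _
    have hle : Real.sqrt 2 * (4 * M / (α * (1 - α) * R)) ≤ 8 * Real.sqrt 2 * M / ((1 - α) * R) := by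
      have hα2 : 1 / α ≤ 2 := by rw [div_le_iff₀ hα0]; linarith
      calc Real.sqrt 2 * (4 * M / (α * (1 - α) * R))
          = Real.sqrt 2 * (4 * M) / ((1 - α) * R) * (1 / α) := by field_simp
        _ ≤ Real.sqrt 2 * (4 * M) / ((1 - α) * R) * 2 := by gcongr
        _ = 8 * Real.sqrt 2 * M / ((1 - α) * R) := by ring
    have h3 : Real.sqrt 2 * (4 * M / (α * (1 - α) * R)) * Real.sqrt ((τ - t₀) * En) ≤
        8 * Real.sqrt 2 * M * Real.sqrt ((τ - t₀) * En) / ((1 - α) * R) := by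
      have := mul_le_mul_of_nonneg_right hle hS
      rwa [div_mul_eq_mul_div] at this
    have hγ : 2 * δ * (δ + Real.sqrt 2 * (4 * M / (α * (1 - α) * R)) * Real.sqrt ((τ - t₀) * En)) ≤
        2 * δ * (δ + 8 * Real.sqrt 2 * M * Real.sqrt ((τ - t₀) * En) / ((1 - α) * R)) :=
      mul_le_mul_of_nonneg_left (by linarith) (by positivity)
    linarith [h1, hγ, hsmall]
  -- ### the ball `B_ρ(x) ⊂ U'`, `ρ = α(1−α)R/4`
  set ρ : ℝ := α * (1 - α) * R / 4 with hρ
  have hρpos : 0 < ρ := by positivity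
  have hρR : ρ ≤ R := by
    rw [hρ]; have : α * (1 - α) ≤ 1 := by nlinarith
    nlinarith
  have hxd : α * R ≤ dist x x₀ ∧ dist x x₀ ≤ R :=
    ⟨not_lt.1 fun h => hx.2 (mem_ball.2 h), mem_closedBall.1 hx.1⟩
  have hgap1 : α * R - ρ - ρ₁ = α * R * (1 - α) / 4 := by rw [hρ, hρ₁]; ring
  have hgap2 : ρ₂ - (R + ρ) = R * (1 - α) * (2 - α ^ 2) / (4 * α) := by
    rw [hρ, hρ₂]; field_simp; ring
  have hgap1' : ρ₁ ≤ α * R - ρ := by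
    have : 0 ≤ α * R * (1 - α) / 4 := by positivity
    linarith
  have hgap2' : R + ρ ≤ ρ₂ := by
    have h2 : 0 < 2 - α ^ 2 := by nlinarith
    have : 0 ≤ R * (1 - α) * (2 - α ^ 2) / (4 * α) := by positivity
    linarith
  have hball : ball x ρ ⊆ U' := by
    intro y hy
    have h1 : dist y x < ρ := mem_ball.1 hy
    have hyx : dist x y < ρ := by rwa [dist_comm]
    have hlo : ρ₁ ≤ dist y x₀ := by linarith [dist_triangle x y x₀, hxd.1]
    have hhi : dist y x₀ ≤ ρ₂ := by linarith [dist_triangle y x x₀, hxd.2]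
    simp only [hU', Set.mem_sdiff, mem_closedBall, mem_ball, not_lt]
    exact ⟨hhi, hlo⟩
  have hU'U₂ : U' ⊆ U₂ := by
    intro y hy
    simp only [hU', hU₂, Set.mem_sdiff, mem_closedBall, mem_ball, not_lt] at hy ⊢
    exact ⟨hy.1.trans hr2.le, hr1.le.trans hy.2⟩
  have hballU₂ : ball x ρ ⊆ U₂ := hball.trans hU'U₂
  have hρ2R : ρ ^ 2 ≤ R ^ 2 := pow_le_pow_left₀ hρpos.le hρR 2
  have hIρ : Icc (t - ρ ^ 2) t ⊆ Icc t₀ τ := fun s hs =>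
    ⟨by linarith [hs.1, ht.1], hs.2.trans ht.2⟩
  have hIρ𝒯 : Icc (t - ρ ^ 2) t ⊆ 𝒯 := hIρ.trans hI
  have hKc : IsCompact (closedBall x₀ (R / α)) := isCompact_closedBall _ _
  have hU₂K : U₂ ⊆ closedBall x₀ (R / α) := fun y hy => hy.1
  have hsmallρ : ∀ s ∈ Icc (t - ρ ^ 2) t, (∫ y in ball x ρ, ymDensityOfBasis b (A s) y) ≤ ε := by
    intro s hs
    have hs𝒯 : s ∈ 𝒯 := hIρ𝒯 hs
    have hc : Continuous fun y => ymDensityOfBasis b (A s) y := continuous_slice_of_continuousOn_slab he_cont hs𝒯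
    refine (setIntegral_mono_set ((hc.continuousOn.integrableOn_compact hKc).mono_set
      (hU'U₂.trans hU₂K)) (ae_of_all _ fun y => he0 s y) hball.eventuallyLE).trans
      (hU'small s (hIρ hs))
  -- (from here on `linarith` must not scan the whole context: use `linarith only`; the
  -- `set` values are frozen to keep definitional unfolding cheap)
  clear_value ρ ρ₁ ρ₂ U' U₂
  have hρ2 : 0 ≤ ρ ^ 2 := sq_nonneg ρ
  have htI : t ∈ Icc (t - ρ ^ 2 / 2) t := by
    constructor
    · linarith only [hρ2]
    · exact le_rfl
  have htI' : t ∈ Icc (t - ρ ^ 2) t := by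
    constructor
    · linarith only [hρ2]
    · exact le_rfl
  have hxI : x ∈ closedBall x (ρ / 2) := by
    rw [mem_closedBall, dist_self]; positivity
  have hε0 : 0 ≤ ε :=
    (setIntegral_nonneg (μ := volume) (s := ball x ρ) (f := fun y => ymDensityOfBasis b (A t) y) measurableSet_ball
      fun y _ => he0 t y).trans (hsmallρ t htI')
  have hρ4 : ρ ^ 4 = (α * (1 - α)) ^ 4 * R ^ 4 / 4 ^ 4 := by rw [hρ]; ring
  have hρ6 : ρ ^ 6 = (α * (1 - α)) ^ 6 * R ^ 6 / 4 ^ 6 := by rw [hρ]; ring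
  -- ### the curvature bound
  have hD4 : 0 < (α * (1 - α)) ^ 4 * R ^ 4 := by positivity
  have hD6 : 0 < (α * (1 - α)) ^ 6 * R ^ 6 := by positivity
  have ha := (hPa (R := ρ) (τ := t) (ε := ε) h𝒯 hA hval hpde x hρpos hIρ𝒯
    (lt_of_lt_of_le hε (min_le_left _ _)) hsmallρ t htI x hxI).2
  rw [hρ4, div_div_eq_mul_div] at ha
  have ha1 : ymDensityOfBasis b (A t) x ≤ Ca * ε * 4 ^ 4 / ((α * (1 - α)) ^ 4 * R ^ 4) := ha
  have ha2 : Ca * ε * 4 ^ 4 / ((α * (1 - α)) ^ 4 * R ^ 4) ≤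
      (4 ^ 4 * Ca + 4 ^ 6 * Cb) * ε / ((α * (1 - α)) ^ 4 * R ^ 4) := by
    rw [div_le_div_iff_of_pos_right hD4]
    have h46 : 0 ≤ Cb * ε := mul_nonneg hCb.le hε0
    linarith only [h46]
  -- ### the `D^*F` bound
  have hb0 := hPb (R := ρ) (τ := t) (ε := ε) h𝒯 hA hval hpde x hρpos hIρ𝒯
    (lt_of_lt_of_le hε (min_le_right _ _)) hsmallρ t htI x hxI
  have hmono : (∫ s in (t - ρ ^ 2)..t, ∫ y in ball x ρ,
      (∑ j, ‖divCurvature (A s) y (b j)‖ ^ 2)) ≤ δ ^ 2 :=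
    (intervalIntegral_setIntegral_mono_of_nonneg h𝒯 hu_cont hu0 hKc hballU₂ hU₂K
      measurableSet_ball hU₂m (hIρ (left_mem_Icc.2 (by linarith only [hρ2]))).1
      (by linarith only [hρ2]) ht.2 hI).trans hδ
  have hCρ : 0 ≤ Cb / ρ ^ 6 := div_nonneg hCb.le (pow_nonneg hρpos.le 6)
  have hb1 : (∑ j, ‖divCurvature (A t) x (b j)‖ ^ 2) ≤ Cb / ρ ^ 6 * δ ^ 2 :=
    hb0.trans (mul_le_mul_of_nonneg_left hmono hCρ)
  rw [hρ6, div_div_eq_mul_div, div_mul_eq_mul_div] at hb1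
  have hb2 : Cb * 4 ^ 6 * δ ^ 2 / ((α * (1 - α)) ^ 6 * R ^ 6) ≤
      (4 ^ 4 * Ca + 4 ^ 6 * Cb) * δ ^ 2 / ((α * (1 - α)) ^ 6 * R ^ 6) := by
    rw [div_le_div_iff_of_pos_right hD6]
    have h44 : 0 ≤ Ca * δ ^ 2 := mul_nonneg hCa.le (sq_nonneg δ)
    linarith only [h44]
  exact ⟨ha1.trans ha2, hb1.trans hb2⟩

end EpsilonRegularity

end Literature.MathematicalPhysics.QuantumLattice
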